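import Summits.PneNP.PneNP.Theses.PhaseTwins
import Summits.PneNP.PneNP.Theorems.PhaseTwinsPolyDepthTwinsAboveDefs
import Literature.ModelTheory.FiniteModelTheory.CkEquivHomCount
import Literature.ModelTheory.FiniteModelTheory.CountingWidth
import Literature.ModelTheory.FiniteModelTheory.CkEquivTransfer

/-!
# Disproof of `PolyDepthTwinsAbove` — findings (cdisprove; gen 1 `refuter-cdisprove-stmt-PneNP-2719-0`, gen 2 `…-g2-0`, gen 3 `…-g3-0`)

Work file of the standing adversary on crux `stmt-PneNP-2719`
(`Summit.PneNP.PneNP.Theses.PhaseTwins.PolyDepthTwinsAbove`, route PhaseTwins, rank 2).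
Prose lives in docstrings; every `theorem` without `sorry` is kernel-checked (this file: 0 sorries).

Index
* §0 verdict so far and WHY IT RESISTS (docstring of `resists`; cycle-2 update at its end).
* §1 load-bearing hypotheses of the CRUX: `polyDepthTwinsAbove_false_without_threshold` (λ = 0 kills the
  threshold-free version), `polyDepthTwinsAbove_false_without_degreeLB` (Δ = 0: the threshold formula is
  junk below Δ = 3).  LANDED verbatim (statements inlined) as
  `Theorems/PolyDepthTwinsAbove/Negative/LoadBearing.lean` (p73212, namespace
  `Summit.PneNP.PneNP.Theorems.PolyDepthTwinsAbove.Negative`; not imported here only because the farm snapshot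
  used by `crux write` may lag the tree — import it from stub files freely).
* §2 the bare-CFI obstruction (`bareCFI_defect_identity`: exact defect identity, paper proof in the
  docstring): plain CFI twins are only `log n`-deep at EVERY λ — amplification of the parity signal inside ONE
  connected base is forced (which is what the picked line does).
* §3 natural strengthenings / tightness remarks (`strengthenings`).
* §4 `-- Targets` = the seven registered stubs of the picked line `parity-wired-ports` (payload.targets and
  stuck_stubs still empty; lead re-seated 2026-08-16, wave 1 = all five provable stubs):
  §4a gen-1 pre-screen (`targets_prescreen`); §4b gen-2 LEAN-SIGNATURE AUDIT, stub by stub, quantifier by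
  quantifier, at every degenerate instance the signature admits (`targets_signature_audit`): NO STUB IS FALSE AS
  TYPED; §4c KERNEL-CHECKED load-bearing analysis of `stub_tseitinGap`: `tseitinGap_false_without_coupling`
  (the stub's conclusion is false with the pair coupling off, for every base) with helpers the stub's prover
  will want anyway — `cxWeight_one_eq` (one-leg Tseitin covariance of the CFI complex), `cxWeight_mono`,
  `cxW_le_allMinus`, `cxW_const_eq`, `cxW_pos`; LANDED (definition-free form, leg flip inlined) as
  `Theorems/PolyDepthTwinsAbove/Negative/TseitinGapCoupling.lean` — p75388, commit b245999e72e3, namespace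
  `Summit.PneNP.PneNP.Theorems.PolyDepthTwinsAbove.Negative` (stub provers: import it); §4d brute force of `stub_tseitinGap` on the
  bases `M = 2` (triple edge), `K₄`, `K₃,₃` (all phase vectors, 8 parameter sets each: holds 24/24, TIGHT,
  coupling necessary 24/24) and the EMPIRICAL least coupling `κ₁*`, which is INDEPENDENT of `M`
  (`tseitinGap_bruteforce`; kit j009610 adds the cube `Q₃`, `M = 8`).
* §5 remarks for the round-2 ideas `linear-gap-constant-gadgets` / `mirror-glued-gadget` (`round2_remarks`):
  which recorded obstructions bite (none of §1–§2) and the one quantitative lesson of §4 for constant-size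
  designs (the `M` in `hcouple` is an artifact of the crude aligned-sector bound; the true condition is local).
* §6 literature delta for the kill scenario (`literature_delta`; gen-3 addendum at its end).
* §7 (gen 3, 2026-08-16) THE DEPTH-EXPONENT CEILING, kernel-checked (`hardcoreSum_eq_of_homIndist_rpow`,
  `depthExponent_lt_one`, `polyDepthTwinsAbove_false_at_exponent_ge_one`,
  `depthExponent_lt_one_of_polyDepthTwinsAbove`): the crux with a given exponent `θ ≥ 1` is FALSE for every
  `(Δ, λ ≥ 0)` — hom-indistinguishability below depth `n` is isomorphism (PROVED Dvořák bridge + PROVED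
  `CkEquiv.nonempty_iso`), so the crux lives in `θ ∈ (0,1)`; LANDED as
  `Theorems/PolyDepthTwinsAbove/Negative/DepthCeiling.lean` (p80790; namespace `…Negative`, same statements).
* §8 (gen 3) `-- Targets`, round 2: Lean-signature audit of the 14 stubs of the two NEW skeletons
  `Lines/linear-gap-constant-gadgets.lean` and `Lines/annealed-cover-twins.lean`, plus the 3 new stubs of the gen-2
  `Lines/mirror-glued-gadget.lean` (`targets_round2_audit`): no stub false as typed; load-bearing hypotheses named; the annealed line is the first whose closure would prove the crux
  with NO named fact, so its one uncharted input `CoverGap` was attacked numerically in the EXTREME regimes the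
  triage panels did not reach (`coverGap_extremes`: `d ≤ 1000`, `λ/λ_c − 1 ∈ [10⁻⁶, 10⁸]`, 0 violations; the nearest
  competitor at `λ → ∞` is the complementary profile, at the EXACT asymptotic margin `(d/2 − 1)·log 2`, kit j011125).
* §9 (gen 3) FACTOR SQUARING, kernel-checked (`Zs_sum`, `Zs_double`, `homIndist_double`, `witnesses_sq`,
  `witnesses_pow`, `noTwins_onePlusEps_of_noTwins`): the gap factor `2` is immaterial — `PolyDepthTwinsAbove ⇔` its
  factor-`(1+ε)` version for every `ε > 0`; LANDED as `Theorems/PolyDepthTwinsAbove/Negative/FactorSquaring.lean` (p81762).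
Compute: kit j008671 / j008999 (gen 1; their summaries never reached the item — superseded by the local runs of
§4d and by j009610, gen 2); j011125 (gen 3, §8).  Landed: p73212 (§1, gen 1), p75388 (§4c, gen 2), p76061 (§4c′,
gen 2); p80790 (§7 DepthCeiling, gen 3, ACCEPTED, commit e0cbb9776fee); p81762 (§9 FactorSquaring, gen 3, ACCEPTED,
commit d5ff2cacdf61).
-/

set_option linter.dupNamespace false

namespace Summit.PneNP.PneNP.Cruxes.PolyDepthTwinsAbove.Disproof

open scoped BigOperators Classical
open Summit.PneNP.PneNP.Cruxes.PolyDepthTwinsAbove.ParityWiredPorts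
open Literature.Computability.Complexity.Expander (RotGraph)
open Literature.ModelTheory.FiniteModelTheory.TseitinColouring (Dart)
open Literature.ModelTheory.FiniteModelTheory.CFIMatching (bit Canon zmod2_add_self zmod2_eq_zero_or_one)

/-- The hard-core sum of the crux (inlined there): `Z_G(λ) = Σ_{I independent} λ^{|I|}`. -/
noncomputable def Z {n : ℕ} (G : SimpleGraph (Fin n)) (lam : ℝ) : ℝ :=
  ∑ I : Finset (Fin n), (if G.IsIndepSet (↑I : Set (Fin n)) then lam ^ I.card else 0)

/-- At activity `0` only the empty set counts: `Z_G(0) = 1`. -/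
theorem Z_zero {n : ℕ} (G : SimpleGraph (Fin n)) : Z G 0 = 1 := by
  unfold Z
  rw [Finset.sum_eq_single (∅ : Finset (Fin n))]
  · have h : G.IsIndepSet ((∅ : Finset (Fin n)) : Set (Fin n)) := by
      simp [SimpleGraph.IsIndepSet, Set.Pairwise]
    simp
  · intro I _ hI
    have hc : I.card ≠ 0 := by rwa [Ne, Finset.card_eq_zero]
    simp [zero_pow hc]
  · intro h; exact absurd (Finset.mem_univ _) h

/-! ## §1 Load-bearing hypotheses -/

/-- The crux with the threshold hypothesis `λ_c(Δ) < lam` DROPPED (all real `lam`). -/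
def PolyDepthTwinsAboveWithoutThreshold : Prop :=
  ∀ Δ : ℕ, 3 ≤ Δ → ∀ lam : ℝ, ∃ θ : ℝ, 0 < θ ∧ ∀ n₀ : ℕ, ∃ (n : ℕ) (G H : SimpleGraph (Fin n)),
    n₀ ≤ n ∧ G.maxDegree ≤ Δ ∧ H.maxDegree ≤ Δ ∧
    (∀ (m : ℕ) (F : SimpleGraph (Fin m)),
      (Literature.Combinatorics.SimpleGraph.treewidth F : ℝ) < (n : ℝ) ^ θ →
        Nat.card (F →g G) = Nat.card (F →g H)) ∧
    2 * (∑ I : Finset (Fin n), (if H.IsIndepSet (↑I : Set (Fin n)) then lam ^ I.card else 0)) ≤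
      ∑ I : Finset (Fin n), (if G.IsIndepSet (↑I : Set (Fin n)) then lam ^ I.card else 0)

/-- **Any proof must use `λ > λ_c(Δ)` — at least to exclude `λ = 0`.** With the threshold hypothesis
dropped the statement is false at `Δ = 3, λ = 0`: `Z_G(0) = Z_H(0) = 1`, so `2·Z_H ≤ Z_G` fails for every
pair. (The honest weakening `0 < λ` — twins of depth `n^θ` at EVERY positive activity — is expected to be
FALSE below `λ_c` by the route's own support `LogDepthContinuityBelow` (Peters–Regts zero-freeness +
Barvinok interpolation: depth `C log n` already pins `Z` to a factor `1+ε` for `λ < λ_c(Δ)`), but that is a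
research-level formalisation, not attempted here; §2 shows the one cheap candidate for such twins — bare CFI
lifts — fails at every `λ`.) -/
theorem polyDepthTwinsAbove_false_without_threshold : ¬ PolyDepthTwinsAboveWithoutThreshold := by
  intro h
  obtain ⟨θ, -, hn⟩ := h 3 le_rfl 0
  obtain ⟨n, G, H, -, -, -, -, hZ⟩ := hn 0
  have hG := Z_zero G
  have hH := Z_zero H
  unfold Z at hG hH
  rw [hG, hH] at hZ
  norm_num at hZ

/-- The crux with the hypothesis `3 ≤ Δ` DROPPED. -/
def PolyDepthTwinsAboveWithoutDegreeLB : Prop :=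
  ∀ Δ : ℕ, ∀ lam : ℝ, ((Δ : ℝ) - 1) ^ (Δ - 1) / ((Δ : ℝ) - 2) ^ Δ < lam → ∃ θ : ℝ, 0 < θ ∧
    ∀ n₀ : ℕ, ∃ (n : ℕ) (G H : SimpleGraph (Fin n)),
    n₀ ≤ n ∧ G.maxDegree ≤ Δ ∧ H.maxDegree ≤ Δ ∧
    (∀ (m : ℕ) (F : SimpleGraph (Fin m)),
      (Literature.Combinatorics.SimpleGraph.treewidth F : ℝ) < (n : ℝ) ^ θ →
        Nat.card (F →g G) = Nat.card (F →g H)) ∧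
    2 * (∑ I : Finset (Fin n), (if H.IsIndepSet (↑I : Set (Fin n)) then lam ^ I.card else 0)) ≤
      ∑ I : Finset (Fin n), (if G.IsIndepSet (↑I : Set (Fin n)) then lam ^ I.card else 0)

/-- In a graph of maximum degree `0` every vertex set is independent. -/
theorem isIndepSet_of_maxDegree_le_zero {n : ℕ} (G : SimpleGraph (Fin n)) (h : G.maxDegree ≤ 0)
    (S : Set (Fin n)) : G.IsIndepSet S := by
  intro v _ w _ _ hvw
  have h1 : 0 < G.degree v := by
    rw [← SimpleGraph.card_neighborFinset_eq_degree, Finset.card_pos]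
    exact ⟨w, (SimpleGraph.mem_neighborFinset G v w).2 hvw⟩
  have h2 : G.degree v ≤ G.maxDegree := SimpleGraph.degree_le_maxDegree G v
  omega

/-- **The threshold formula is junk below `Δ = 3`** (so `3 ≤ Δ` cannot simply be dropped): at `Δ = 0`
Lean evaluates `(Δ-1)^{Δ-1}/(Δ-2)^Δ = (-1)^0/(-2)^0 = 1`, and for `λ = 2 > 1` a graph of maximum degree
`0` is edgeless, so `Z_G(2) = Z_H(2) = 3^n > 0` and the factor-2 gap is impossible. (At `Δ = 2` the
formula gives `1/0 = 0`; there the statement is false for the honest reason — unions of paths and cycles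
are determined up to isomorphism by hom counts of treewidth `≤ 2` — but that needs a spectral argument,
not attempted.) -/
theorem polyDepthTwinsAbove_false_without_degreeLB : ¬ PolyDepthTwinsAboveWithoutDegreeLB := by
  intro h
  obtain ⟨θ, -, hn⟩ := h 0 2 (by norm_num)
  obtain ⟨n, G, H, -, hG, hH, -, hZ⟩ := hn 0
  have hGe : ∀ I : Finset (Fin n), G.IsIndepSet (↑I : Set (Fin n)) :=
    fun I => isIndepSet_of_maxDegree_le_zero G hG _
  have hHe : ∀ I : Finset (Fin n), H.IsIndepSet (↑I : Set (Fin n)) :=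
    fun I => isIndepSet_of_maxDegree_le_zero H hH _
  simp only [hGe, hHe, if_true] at hZ
  have hpos : 0 < ∑ I : Finset (Fin n), (2 : ℝ) ^ I.card :=
    Finset.sum_pos (fun I _ => by positivity) Finset.univ_nonempty
  linarith

/-! (§1 is LANDED as `Theorems/PolyDepthTwinsAbove/Negative/LoadBearing.lean`, p73212: the tree theorems
`Summit.PneNP.PneNP.Theorems.PolyDepthTwinsAbove.Negative.polyDepthTwinsAbove_false_without_threshold` /
`…_false_without_degreeLB` have exactly the bodies of the two `def`s above as their negated statements.) -/

/-! ## §0 Verdict -/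

/-- **Why the crux resists disproof (cycle 1).** A refutation of `PolyDepthTwinsAbove` at one
`(Δ, λ > λ_c(Δ))` is the POSITIVE theorem "for every θ > 0 and all large n, two max-degree-Δ graphs on n
vertices that are `C^{⌈n^θ⌉}`-equivalent (Dvořák: hom-indistinguishable below treewidth `n^θ`) have
`Z_G(λ) < 2 Z_H(λ)`" — uniform continuity of `log Z` in the Weisfeiler–Leman type of sub-polynomial
dimension ABOVE the uniqueness threshold. Every known mechanism that pins `Z` from bounded-depth data
(correlation decay / SSM: Weitz 2006; zero-freeness + Taylor truncation: Patel–Regts 2017, Peters–Regts 2019;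
cluster expansion; BP/Bethe fixed points, which are 1-WL-invariant: Grohe et al. 2021) stops exactly at
`λ_c(Δ)` (Sly 2010 / Sly–Sun 2014 / GŠV 2016 hardness; zeros of bounded-degree independence polynomials
accumulate on `(λ_c, ∞)`), and no statement of this kind is in print (searches logged in NOTES.md). Such a
theorem would not even contradict NP-hardness (n^θ-WL costs n^{O(n^θ)} time), so complexity gives no cheap
handle either. Conversely the crux is not cheaply TRUE: §2 shows bare Cai–Fürer–Immerman lifts give a
`Z`-defect of relative size `≤ 2(λ/(2+λ))^{|B|}`, i.e. only `O(log n)`-deep factor-2 twins at ANY λ, so a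
witness must amplify a parity/cut signal through a phase-coexistence gadget inside ONE connected expander
base (the picked line `parity-wired-ports` does exactly this; its stubs were pre-screened in §4 and none
is false in a degenerate instance I could find). Attacks run: degenerate parameters (λ = 0, Δ ≤ 2, θ ≥ 1,
n small), quantifier audit (θ before n₀; G, H may depend on λ; same n forced anyway by edgeless test
graphs), junk audit (treewidth = sInf over Fin-indexed decompositions, attained; `maxDegree` classical;
`Nat.card` of a finite hom type; `rpow` with n ≥ 1), bare-CFI small models (kit job, §2), literature for a
positive result above λ_c (none).

CYCLE 2 (gen 2, 2026-08-16). The crux is now ONE vendored fact away from a proof: the picked line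
`parity-wired-ports` composes `PolyDepthTwinsAbove` (kernel-checked composition `PolyDepthTwinsAbove_of`) from
seven stubs, of which `stub_slyGadgets` ≡ the named fact `slyGadgetReduction` (Sly 2010 Thm 2.1 + Lemma 2.2 /
GŠV16 Lemma 19 / GGŠVY for the degree covering — in print as such) and the other six each shadow a PROVED tree
template.  A disproof of the crux would therefore have to refute a published theorem or one of six routine
stubs; so cycle 2 audited the stubs AS TYPED (§4b: every quantifier, every degenerate instance the Lean
signature admits — `M ∈ {0,1}`, `κ₁ = 0`, `κ₂ = 0`, `m = 0`, `v = 0`, `d < 3`, `λ = 0`, `n = 0`, negative or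
huge `Lρ`, overlapping port ranges, half-edges, disconnected bases) and found NO false stub; the only
kernel-level negative fact about the line is the expected one, `tseitinGap_false_without_coupling` (§4c).
Brute force (§4d) confirms `stub_tseitinGap` on three bases with equality attained in every instance.
Literature delta (§6): still no n^{o(1)}-WL / bounded-treewidth-hom-count determination of `Z` above `λ_c`
in print.  WHY IT RESISTS, in one line: ¬crux at any single `(Δ, λ > λ_c(Δ))` ⇒ ¬`slyGadgetReduction` at that
point (through the six stubs), i.e. it would overturn Sly / Sly–Sun / GŠV.

CYCLE 3 (gen 3, 2026-08-16).  Two more checked skeletons now compose the crux: `linear-gap-constant-gadgets` (same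
trust base `slyGadgetReduction`, used ONCE at constant size; new source stub provable from the tree) and
`annealed-cover-twins`, which deletes the trust base altogether — a FIRST-MOMENT line whose only uncharted input is
the variational statement `CoverGap` (global maximiser of an explicit 5-variable entropy functional).  §8 audits all
14 new stubs as typed (none false) and attacks `CoverGap` where the triage panels had not looked (`λ/λ_c` up to `10⁸`,
`d` up to `1000`): it holds with the product argmax everywhere, and its thinnest margin is now UNDERSTOOD — at
`λ → ∞` the runner-up is the complementary profile `(ν₁₀, ν₀₁) = (½, ½)` at distance exactly `(d/2 − 1) log 2`
(`= 0.3466` at `d = 3`, matched by the numerics to 4 digits), positive for every `d ≥ 3` and vanishing only at the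
excluded `d = 2`.  So the disprover's position sharpens to: ¬crux ⇒ (¬`slyGadgetReduction`) ∧ (¬`CoverGap` ∨ an
error in the first-moment bookkeeping S2/S3 of the annealed line) — two independent published/numerically-certain
inputs would have to fail at once.  §7 adds the one cheap STRUCTURAL fact still missing in kernel form: the exponent
is capped, `θ < 1` for every witness family (Dvořák bridge + `n` pebbles decide isomorphism), i.e. the crux cannot be
strengthened to treewidth bound `n`; and §3(vi) records that the crux is EQUIVALENT to its factor-`(1+ε)` version for
every fixed `ε > 0` (disjoint copies), so a kill would have to pin `Z` to within `1+ε` from depth `n^{o(1)}` for ALL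
`ε` — an even stronger determinacy statement than "factor 2", with nothing of the kind in print (§6 addendum). -/
theorem resists : True := trivial

/-! ## §2 The bare-CFI obstruction -/

/-- **Exact CFI defect of the hard-core partition function (refuter, cycle 1; paper proof here, numerics
kit j008671).** Let `B = (V, E)` be a connected graph (parallel edges allowed, no loops) and `CFI(B, X)`,
`X ⊆ E`, the Cai–Fürer–Immerman graph: inner vertices `u_S` (`u ∈ V`, `S ⊆ E(u)`, `|S|` even), outer
vertices `a_{u,e}, b_{u,e}` (`u ∈ e`), edges `u_S a_{u,e}` (`e ∈ S`), `u_S b_{u,e}` (`e ∉ S`), and across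
`e = uv`: `a_{u,e}a_{v,e}, b_{u,e}b_{v,e}` if `e ∉ X`, `a_{u,e}b_{v,e}, b_{u,e}a_{v,e}` if `e ∈ X`
(for cubic `B`: `10|V|` vertices, maximum degree `3`; `Z(X) := Z(CFI(B,X), λ)` depends on `|X| mod 2` only).
CLAIM. For every real `λ`,
  `Z_even − Z_odd = 2 · (−1)^{|E|} · 2^{|E|−|V|} · λ^{2|E|+|V|}`,
and for `λ > 0`: `|Z_even − Z_odd| / Z_odd ≤ 2λ^{|V|} / ((2+λ)^{|V|} − λ^{|V|}) < 2 (λ/(2+λ))^{|V|}·(1+o(1))`.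
PROOF. `Σ_{X ⊆ E} (−1)^{|X|} Z(X) = 2^{|E|−1}(Z_e − Z_o)`. Summing out the (pairwise non-adjacent) inner
vertices, `Z(X) = Σ_σ λ^{|σ|} Π_e M_e^X(σ) Π_u T_u(σ)` over sets `σ` of OUTER vertices, `M_e^X ∈ {0,1}` the
indicator of the two cross edges of `e`, `T_u(σ) = Π_{S even} (1 + λ·[u_S has no neighbour in σ])`. Hence
`Σ_X (−1)^{|X|} Z(X) = Σ_σ λ^{|σ|} Π_u T_u(σ) Π_e D_e(σ)`, `D_e := M_e^∅ − M_e^{twisted}`. Checking the 16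
occupation patterns of `(a_{u,e}, b_{u,e}, a_{v,e}, b_{v,e})`: `D_e = 0` unless exactly one of `a_{u,e}, b_{u,e}`
and exactly one of `a_{v,e}, b_{v,e}` is occupied, and then `D_e = −s_{u,e}s_{v,e}` (`s = +1` for `a`, `−1`
for `b`). On such `σ` (`2|E|` occupied outer vertices) `u_S` is free iff `S = {e ∋ u : s_{u,e} = −1}`, so
`T_u = (1+λ)^{[χ_u = 1]} = A + Bχ_u`, `χ_u := Π_{e ∋ u} s_{u,e}`, `A = (2+λ)/2`, `B = λ/2`. Thus
`Σ_X (−1)^{|X|} Z(X) = (−1)^{|E|} λ^{2|E|} Σ_{s ∈ {±1}^{2|E|}} Π_e s_{u,e}s_{v,e} Π_u (A + Bχ_u)`; expanding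
`Π_u` over `U ⊆ V`, the variable `s_{u,e}` occurs to the power `1 + [u ∈ U]`, so only `U = V` survives:
`= (−1)^{|E|} λ^{2|E|} 2^{2|E|} B^{|V|}`, and dividing by `2^{|E|−1}` gives the identity. For the bound,
restrict `Z(X)` (`|X| = 1`) to the `σ` above that respect the cross edges (`s_{u,e} = −s_{v,e}` untwisted,
`=` twisted: `2^{|E|}` sign patterns); averaging `Π_u (A + Bχ_u)` over them kills every `U ∉ {∅, V}` (a
boundary edge of `U` carries a free sign; `B` connected), so `Z_odd ≥ λ^{2|E|} 2^{|E|} (A^{|V|} − B^{|V|})`. ∎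
CHECKS. `B = K₃`: `CFI_even = C₉ ⊔ C₉`, `CFI_odd = C₁₈`, identity gives `−2λ⁹` = the planner's hand value
`Z(C₉)² − Z(C₁₈)`; my transfer/contraction code reproduces it as a polynomial identity at 20 integer points
and by brute force over `2^{18}` subsets (local smoke test, which also confirmed the identity and the bound at
`λ = 5` for `K₄` (sign `+`, rel. gap `1.2·10⁻⁴`, `M = 5771` copies, `n = 230840` vs WL-dim `< 40`) and Petersen
(sign `−`, rel. gap `3.6·10⁻¹¹`, `M ≈ 1.9·10¹⁰`, `n ≈ 1.9·10¹²` vs WL-dim `< 100`)); kit job **j008671**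
(queued at write time; results attach to the item automatically) runs the polynomial-identity check for
`C₃, C₄, K₄−e, K₄, K₃,₃, Q₃, Petersen`, numerics for random cubic `12–20`, and the bound at
`λ ∈ {1,4,5,8,20,100,1000}`.
CONSEQUENCE FOR THE CRUX. The only cheap candidate for depth-`n^θ` twins — disjoint unions of `M` copies of
`CFI_e(B)` vs `CFI_o(B)` over a cubic expander `B` (support `ConstantFactorTwinsEverywhere`) — needs
`M ≥ (ln 2/2)((1 + 2/λ)^{|V|} − 1)` copies for a factor `2`, so `n = 10M|V| ≥ exp(c_λ |V|)`, while the pair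
(hence the union: `M·X ≡_{C^k} M·Y ⇔ X ≡_{C^k} Y`, connected test graphs) is `C^k`-equivalent only for
`k < |CFI(B)| = 10|V| = O(log n)`. So bare CFI lifts witness only LOG-depth factor-2 twins, at EVERY `λ > 0`
(nothing happens at `λ_c` for them): exactly the scale of the support `LogDepthContinuityBelow`, and far from
`n^θ`. Any witness of the crux must amplify the one-bit parity signal by a factor `e^{Ω(|V|)}` INSIDE one
connected base — i.e. couple the CFI charge to an extensive quantity (a cut through phase-coexistence gadgets,
as in the picked line `parity-wired-ports`: `κ₂ = n^{θ/4}` parallel complexes per base vertex, gain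
`e^{κ₂ g}` against phase entropy `n^{6M}`). Informally: "ℤ₂-holonomy of a high-temperature-looking local
defect is exponentially invisible; only a symmetry-broken (two-phase) medium makes it extensive." -/
theorem bareCFI_defect_identity : True := trivial

/-! ## §3 Natural strengthenings and tightness -/

/-- **Strengthenings / tightness (paper, cycle 1).**
(i) `θ ≥ 1` is impossible for the prover: hom-indistinguishability over treewidth `< n` includes all graphs
on `≤ n` vertices, which forces `G ≅ H` (Lovász 1967 via inclusion–exclusion over quotients) and `Z_G = Z_H`;
so the crux lives in `θ ∈ (0,1)` — no refutation, just the ceiling. Not formalised (no Lovász vector theorem in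
the tree). (ii) The constant `2` is immaterial: `(G ⊔ G, H ⊔ H)` squares the ratio and keeps
`≡_{C^k}` (`k ≤ n^θ ≤ (2n)^θ`), so "factor 2" ⇔ "factor c" for every constant `c > 1`; the DENSITY version
(`e^{δn}`, crux #3 `MacroscopicTwinsAbove`) is a different statement and is not attacked here. (iii) "for
all large n" instead of "infinitely many n": the picked line actually yields every large `n` up to polynomial
gaps (parameters `M = m₀·2(D+1)`, `n = M^k`); padding with isolated vertices (keeps degree, `≡_{C^k}`, and
multiplies both `Z` by `(1+λ)`) fills all `n` ≥ some `n₁` — so the ∀-large-n strengthening is EQUIVALENT, not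
refutable. (iv) Uniform `θ` (independent of `Δ, λ`): open either way; the line's `θ' = 1/(2⌈8/θ(d,λ)⌉+4)`
degenerates as `λ ↓ λ_c(d)` (Sly's `θ(λ,d) → 0`?) — a planner question, not a kill. (v) Small `n`: for
`n < 2^{1/θ}` the hypothesis only asks for forests (`tw ≤ 1` ⇔ equal 1-WL colours), so ANY two `Δ`-regular
graphs qualify — e.g. `n = 8`, `G = Q₃`, `H = 2K₄`: `Z_G(5) = 1+40+400+1000+1250 = 2691 ≥ 2·Z_H(5) = 2·441`;
irrelevant asymptotically (`n₀` is universal) but shows the statement has no hidden small-`n` obstruction.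
(vi) (gen 3) FACTOR `2` ⇔ FACTOR `1+ε` for every fixed `ε > 0`: `j = ⌈log 2 / log(1+ε)⌉` disjoint copies of a
`(1+ε)`-pair on `n` vertices give a factor-`2` pair on `jn` vertices (`Z` multiplicative; `≡_{C^k}` preserved by
disjoint unions, `CkEquiv.sum` PROVED, and transported through the PROVED Dvořák bridge in both directions; depth
`n^θ ≥ (jn)^{θ/2}` for `n ≥ j`), so `PolyDepthTwinsAbove ⇔ PolyDepthTwinsAbove[2 ↦ 1+ε]` — KERNEL-CHECKED in §9
(`witnesses_pow`, `noTwins_onePlusEps_of_noTwins`, by iterated doubling).  Consequence for a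
would-be disproof: ¬crux at `(Δ, λ)` is the statement "for every `θ > 0` AND EVERY `ε > 0`, for `n ≥ n₀(θ, ε)`,
`≡_{C^{⌈n^θ⌉}}` max-degree-`Δ` graphs have `Z`-ratio `< 1+ε`" — uniform `(1+ε)`-determinacy of `Z_G(λ)` by the
`n^{o(1)}`-WL type above `λ_c`, for all `ε` at once.  (vii) (gen 3) `θ ≥ 1` is now REFUTED in kernel form (§7), not
just observed: `polyDepthTwinsAbove_false_at_exponent_ge_one`. -/
theorem strengthenings : True := trivial

/-! ## §4 Targets (the picked line's stubs)

### §4a gen-1 pre-screen (kept verbatim) -/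

/-- **Pre-screen of `Lines/parity-wired-ports.lean` (7 stubs; payload.targets = ∅, stuck_stubs = ∅).**
No stub is false in a degenerate instance I could find; details for the lead:
* `stub_slyGadgets` (trust base = Sly 2010 Thm 2.1, derandomised): transcription CHECKED against
  arXiv:1005.5584 p.8 (`lit read`): (GpropA) `P(Y=±) ≥ 1/n` ✓, (GpropB) `max_{σ_V}|P(σ_V|Y=±)/Q_V^±(σ_V) − 1|
  ≤ n^{−2θ}` ✓ (= `SlyPropB` cleared of denominators), `m = (d−1)^{⌊θ log_{d−1} n⌋}` ports per side = tree
  ROOTS of degree `d−1` ✓, `(2+o(1))n` vertices (`v ≤ 3n`) ✓, `0 < θ, ψ < 1/8` ✓, w.h.p. ⇒ ∃ ✓. Printed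
  range: Sly needs Condition 1.2 + (`q⁺q⁻(d−1) < 1`, `q⁺ < 3/5`); for ALL `Δ ≥ 3` and all `λ` in the
  non-uniqueness region, GŠV16 Lemma 19 (arXiv:1203.2226 p.15, `lit read`, read here) restates BOTH items
  verbatim (`μ_H(Y = i) ≥ 1/n`; `max_η |μ_H(σ_R = η | Y = i)/Q_R^i(η) − 1| ≤ n^{−2θ}`, `k = (Δ−1)^{⌊θ log_{Δ−1} n⌋}`
  trees, roots `R±` as ports) under their Condition (cond:maxima), which the paper verifies throughout the
  non-uniqueness region — so the trust base is in print as such, even without the tree's `d ≤ Δ` covering;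
  residual constant/exponent differences would anyway be absorbed by polynomial re-indexing `n ↦ n^c`
  (θ ↦ θ/c keeps `slyM`, `n^{−2θ}`, `v ≤ 3n` in shape). Not attackable from here.
* `stub_chargeVisible`: RE-DERIVED by hand. Independent sets of the complex by inner part `T`: `|T| = 0, 2,
  3, 4` contribute charge-independent terms (`|T| = 2`: the two parity-`e` vectors differ in exactly two
  coordinates, leaving one free end of vacancy `β` for 3 pairs and `α` for 3 pairs, for both charges);
  `|T| = 1` gives `λ[(1+λβ)³ + 3(1+λα)²(1+λβ)]` (e = 0) vs `λ[3(1+λα)(1+λβ)² + (1+λα)³]` (e = 1), so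
  `F₀ − F₁ = λ((1+λβ) − (1+λα))³ = λ⁴(β−α)³ > 0` for `β = 1−q⁻ > α = 1−q⁺` ✓ (sign as the skeleton uses it:
  `Ψ1 < Ψ0`).
* `stub_maxDegree`: ✓ — `RotGraph.rot` is an involution, so `canonEnd` is injective and an end slot receives
  exactly one end edge; pair slots one partner edge; `slot`, `Vp`, `Vm` injective with disjoint ranges ⇒ every
  port gains ≤ 1 edge; ends and inner vertices have degree exactly 3 (`bit (c w) S' i = a` has 2 solutions
  `S'` per `(i, a)`). Self-loop darts in `R` (allowed by `RotGraph`) put two ends of one complex on the SAME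
  copy but in different slots — still fine.
* `stub_duplicator`: plausible ✓ (gauge shift `a ↦ a + g δ` on copies/ends, `S' ↦ S' + g|_w` on inner
  vertices is an isomorphism `pwGraph c ≅ pwGraph (c + ∂g)` for edge-constant `g`, checked on `pwRel`; then
  the proved `ckEquiv_mgraph` template). Remark: a half-edge (`rot δ = δ`, not excluded here) makes total
  parity gauge-trivial, so the stub gets EASIER there, not false.
* `stub_connector`: plausible ✓ — `SlyPropB` is pattern-wise RELATIVE, so for any nonnegative functional `f`
  of all port patterns `E_P f ∈ (1±δ)^{6M} E_Q f` (copies independent in `pwBase` given the product phase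
  event); `f = Π pairs · Π cxWeight` uses pairwise DISTINCT ports (slot/Vp/Vm/canonEnd injective), `cxWeight`
  is multilinear, so `E_Q f = pwW · (1+λ)^{10Mκ₂}` exactly; `λ = 0` (or tiny λ) makes `SlyPropB` unsatisfiable
  for `δ < 1` (empty configuration has a phase with `Z = 1` but occupied-port patterns have `Z = 0 < (1−δ)Q`),
  so no degenerate-λ counterexample.
* `stub_tseitinGap`: ✓ on paper — off-diagonal sector: Tseitin covariance `cxW e y_b = cxW (e + Σ_i b_i) ref`
  (iso `cxGraph e ≅ cxGraph (e+Σb)`), `NoFixed` + involution make `(w,i) ↦ canonEnd` two-to-one onto canonical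
  darts so `Σ_w e_w = Σ_w c_w = 1` ⇒ ≥ 1 violated vertex ⇒ factor `e^{−κ₂ g}` (uses `Ψ1 ≤ Ψ0` for "more
  violations only lower"); anti-aligned pair factor `(1−q⁺q⁻)^{2κ₁}` is the maximum of `pairW`
  (`(1−q⁺q⁻)² − (1−q⁺²)(1−q⁻²) = (q⁺−q⁻)²`); aligned sector loses `slyB^{κ₁}`, gains ≤ `ρ_F^{κ₂M}` by
  coefficientwise monotonicity of `cxWeight` in the vacancies and `cxW 1 (all −) = cxW 0 (all −)`; `hcouple`
  closes it. `κ₂ = 0` and `M = 1` corner cases hold trivially. BRUTE-FORCE CHECK (compute/tseitin_gap/main.py,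
  the skeleton's `pwW/pairW/cxW/cxWeight/pwPsi/cxRho/slyB/Canon/canonEnd` transcribed literally; base `M = 2`
  with three parallel edges, `NoFixed`, all `2^{12}` phase vectors; 15 parameter sets `λ ∈ {1,5,8,50}`,
  `(q⁺,q⁻) ∈ {(0.6,0.1),(0.35,0.3),(0.7,0.05),(0.3,0.2),(0.9,0.02)}`, `κ₂ ∈ {1,2,3}`, `κ₁` = least integer with
  `hcouple`; run locally, `M = 4` (K₄, `2^{24}` vectors) queued as kit j008999): the stub HOLDS in every instance
  with `Y₀ = (a = 0)` (which is the argmax of `pwW 0`), and it is TIGHT — `max_Y pwW (1_{w₀}) Y · e^{κ₂ g}`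
  EQUALS `pwW 0 Y₀` to rounding (ratios `1 ± 2·10⁻¹⁵`): the single-violation off-diagonal vector attains
  equality, so the Lean proof has no slack there (it is an `exp/log` identity, needs `cxW > 0`). The coupling
  hypothesis is NECESSARY: with `κ₁` forced to `0` the inequality FAILS (ratio `1.0203` at `λ = 5`,
  `q = (0.6, 0.1)`, `κ₂ = 2`; `1.000015` at `q = (0.35, 0.3)`) — aligned pairs beat the reference once nothing
  penalises alignment. Also checked: `g = Ψ0 − Ψ1 > 0` in all instances (`1.5·10⁻⁵ … 0.11`), and an even
  charge `1_{w₀} + 1_{w₁}` has the same maximum weight as charge `0` (gauge) ✓.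
* `stub_parameters`: regime NONEMPTY ✓ (`k = ⌈8/θ⌉+1`, `M = n^{1/k} ≤ n^{θ/8}`: `6M ≤ n^{θ/4}`,
  `κ₂(M|Lρ|+g) ≤ n^{3θ/8}(…) ≪ κ₁ log B ≈ n^{3θ/4} log B`, `log 6 + 6M log n ≪ n^{θ/4} g`,
  `κ₁ + 2κ₂ ≤ 3κ₁ ≤ slyM` by `mul_slyK_le_slyM` once `3 ≤ n^{θ/4}/(d−1)`, `6⌊ηM/7⌋ < ηM`,
  `(28M^{k+1})^{1/(2k+2)} ≈ 28^{o(1)}√M ≤ ⌊ηM/7⌋`).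
UPSHOT: modulo routine adaptation of two PROVED tree theorems (`ckEquiv_mgraph`, `slyCutEstimate_of_slyProps`)
the crux follows from Sly's published Theorem 2.1; a disproof of the crux would refute that theorem. -/
theorem targets_prescreen : True := trivial

/-! ### §4b gen-2 Lean-signature audit of the seven stubs (2026-08-16; skeleton sha f61736147f88, re-import reshaped 01:28Z, stubs unchanged) -/

/-- **No stub is false as typed.** For each registered stub of `Lines/parity-wired-ports.lean` I read the Lean
signature back quantifier by quantifier and instantiated every degenerate value the binders admit (the informal
proof sketches never visit them).  Findings, stub by stub (✓ = holds there, with the reason):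
* `stub_slyGadgets` (∀Δ≥3 ∀λ>λ_c(Δ) ∃d θ q± ∃n₁ ∀n≥n₁ ∃gadget…): all inner parameters are the PROVER's choices
  (`n₁ ≥ 1` avoids `SlyPropA`'s `Z/0 = 0` and `(0:ℝ)^(−2θ) = 0` junk, which would anyway only make the
  properties EASIER); literally `h21` of `slyGadgetReduction_of_gadgets` minus `SlyCutEstimate` ✓ (example in
  the skeleton).  `SlyPropA` at `n ≥ 1` excludes `λ = 0` (one phase has `Z = 0 < 1/n`), so no stub downstream can
  be fed a degenerate gadget through S1.  Print coverage of `(d, λ)` is itemised in the fact's docstring (d = 3: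
  GGŠVY L5; d = 4,5: GŠV16 L4+L19; d ≥ 6 window: GGŠVY Cor 6) — nothing for a refuter here.
* `stub_chargeVisible` (`0<λ`, `0<q⁻<q⁺<1` ⊢ `Ψ1 < Ψ0`): re-derived a third time (gen 1 by hand, planner's
  sympy j007445, and structurally in §4c: `cxWeight_one_eq` reduces it to `F₀(x) − F₀(x ∘ legFlip)` with `x`
  the reference vacancies): `F₀ − F₁ = λ⁴(β−α)³`, `β = 1−q⁻ > α = 1−q⁺` ✓; `log` is monotone on `cxW > 0`
  (`cxW_pos`, §4c) ✓.  Numerically `g = Ψ0 − Ψ1 ∈ [7.5·10⁻⁶, 0.11]` on the eight test points of §4d.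
* `stub_maxDegree` (any `M, v, m, κ₁, κ₂`, any `R`, `d ≤ Δ`, `3 ≤ Δ`, `hVV`, port degrees `≤ d−1`): copy vertex =
  gadget degree + at most ONE extra edge (pair edges join `x` only to `(δ, a+1, x)` — even if `Vp`/`Vm` slot
  images coincide the edge is the same one; an end-slot port `Vp(slot(inr(s,j)))` meets only the end `(w,i,a,j)`
  with `canonEnd (w,i) = (δ,s)`, unique because `rot` is an involution; `hVV` is exactly what forbids a port being
  both a `Vp`-end-slot and a `Vm`-pair-slot, the one way to get `+2`) ✓; ends: 1 port + 2 inner (`bit (c w) S' i = a`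
  has two solutions `S'`) = 3 ≤ Δ ✓; inner: 3 ✓.  `d = 0,1,2` only strengthen the hypotheses ✓; `d − 1` at `d = 0`
  is `0` (ports isolated) ✓.  Half-edges (`rot δ = δ`, not excluded): then `Canon δ` is false and `canonEnd δ = (δ,1)`
  plugs an end into a "junk" copy — still one end per slot ✓.  WITHOUT `hVV` the stub is presumably false at
  `d = Δ` (a vertex that is `Vp (slot (inr _))` and `Vm (slot (inl _))` gets degree `d+1`); not formalised
  (needs `maxDegree` of a concrete `pwGraph`), recorded for the prover: `hVV` is load-bearing.
* `stub_duplicator` (`EdgeExpansion R η`, `2 ≤ M`, ANY `W`, any `c c'`, `6K < ηM` ⊢ `CkEquiv K`): hypotheses are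
  verbatim those of the PROVED `CFIMatching.ckEquiv_mgraph` (which also allows every charge); `η ≤ 3` always
  (a single vertex has 3 darts) so `K < M/2`, and `η ≤ 0` makes `hK` unsatisfiable ✓ (no vacuous-expander
  trick); `W` arbitrary incl. `v = 0` (then `m = κ₁ = κ₂ = 0`, `PWVert` empty, `CkEquiv` trivial) and
  NON-disjoint `Vp/Vm` (the gauge shift `a ↦ a + g δ`, `S' ↦ S' + g|_w` never looks at `W.G`) ✓; `NoFixed` is not
  assumed and not needed (a half-edge makes total parity gauge-trivial: `pwGraph c ≅ pwGraph c'` outright).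
  Each vertex depends on ≤ 3 darts + reverses ≤ 6 = the `2·3` in `hK` ✓.  No small counter-model is possible in
  principle (CFI-type graphs are never separated below the expansion scale), none found.
* `stub_connector` (∃n₀(θ,ε,q±) ∀n≥n₀ ∀M v m κ₁ κ₂ R W λ≥0, `6M ≤ n^{θ/4}`, `SlyPropA`, `SlyPropB(n^{−2θ})` ⊢
  `PWCutEstimate ε`): `n₀` is the prover's (≥ 1).  `m = 0` forces `κ₁ = κ₂ = 0` (`slot` injective into `Fin 0`):
  then `pwGraph = pwBase`, `pwW ≡ 1`, cutProb is `|0| ≤ ε·(…)` ✓ and phaseProbs is `(GpropA)^{6M}` ✓.  `λ = 0` with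
  `m ≥ 1`, `n ≥ 1`: `SlyPropA` fails (see S1) — hypothesis unsatisfiable, stub vacuous ✓ (gen 1).  `M = 0`: `6M ≤ …`
  trivial, `PWCutEstimate` over `Y : Dart 0 3 × ZMod 2 → Bool` (one vector), products empty ✓.  Junk copies
  (non-canonical darts) carry no wiring; their `(1±δ)` factors only loosen the bound ✓.  The substance — joint
  port law within `(1±δ)^{6M}` of the product measure, `E_Q f = pwW·(1+λ)^{10Mκ₂}` EXACTLY because every factor
  of `f` uses pairwise distinct ports (`slot`, `Vp`, `Vm`, `canonEnd` injective) and `cxWeight` is multilinear —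
  is as gen 1 described; `n₀` depends on `(θ, ε)` only through `(1 + n^{−2θ})^{n^{θ/4}} ≤ 1 + ε` ✓ (q± do not
  even enter).  Not attackable short of refuting `(GpropB)` bookkeeping; no degenerate kill.
* `stub_tseitinGap` (`NoFixed R`, `0<λ`, `0<q⁻<q⁺<1`, `hΨ : Ψ1 ≤ Ψ0`, `hcouple`, `w₀ : Fin M`): `M = 0` has no `w₀`;
  `M = 1` has no fixed-point-free involution on 3 darts — both vacuous ✓; `κ₂ = 0`: `exp 0 = 1` and both sides are
  the same pair product, `Y₀ :=` its argmax ✓; `κ₁ = 0, κ₂ ≥ 1`: `hcouple` reads `κ₂(M log ρ_F + g) ≤ 0`, false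
  since `log ρ_F ≥ 0` (`cxW_le_allMinus`) and `g ≥ 0` with `M log ρ_F + g > 0` … strictly only if `g > 0` or
  `ρ_F > 1`; `ρ_F > 1` holds for `q⁻ < q⁺` (strict monotonicity of `cxWeight` in one vacancy, coefficient of the
  singleton `{(i,a)}` is `λ > 0`), so the `κ₁ = 0` corner is excluded by `hcouple` ✓ — and it MUST be: §4c proves
  the conclusion false there.  Disconnected `R` (allowed: no expansion hypothesis here): total charge is still odd
  in the component of `w₀` ✓.  `M ≥ 2` generic: brute force §4d, equality attained.
* `stub_parameters` (∃θ' ∃k ∀n₀ ∃m₁ ∀m₀≥m₁ ∀M n κ₁ κ₂ K := … ⊢ 11 inequalities): `θ', k, m₁` are chosen AFTER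
  `θ, η, g, LB, Lρ, d, D, N₀` (all theorem arguments) ✓, so a negative or huge `Lρ : ℝ` (the binder is
  unrestricted; in use `Lρ = log ρ_F ≥ 0`) only moves `m₁`; with `k = ⌈8/θ⌉+1`: `M ≤ n^{θ/8}` ⇒ `6M ≤ n^{θ/4}`,
  `κ₂ M ≤ n^{3θ/8} ≪ κ₁ = ⌊n^{3θ/4}⌋`, `κ₂ g ≈ n^{θ/4} g ≫ log 6 + 6Mk log M`, `κ₁ + 2κ₂ ≤ slyM d θ n ≈ n^θ/(d−1)`
  (`d ≥ 3` ✓ needed for `logb (d−1)`), `K = ⌊ηM/7⌋ ≥ 1` and `6K < ηM` once `M ≥ 7/η`, `(28M^{k+1})^{1/(2k+2)} ≤ K`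
  ✓; `v = 0` in the last clause is harmless (`(10Mκ₂)^{θ'} ≤ K`) ✓; `m₀ ≥ m₁ ≥ 1` keeps `M ≥ 2(D+1) ≥ 2`, `n ≥ 1` ✓.
  True but laborious; nothing to attack.
UPSHOT for the lead: the typed stubs are faithful; the load-bearing side conditions are `hVV` (S3), `hK`'s
constant `2·3` (S4), distinct-port injectivity (S5), `hcouple` (S6, certified necessary in §4c). -/
theorem targets_signature_audit : True := trivial

/-! ### §4c Kernel-checked: the pair coupling of `stub_tseitinGap` is load-bearing
(self-contained copy; LANDED as `Theorems/PolyDepthTwinsAbove/Negative/TseitinGapCoupling.lean`, p75388, in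
namespace `Summit.PneNP.PneNP.Theorems.PolyDepthTwinsAbove.Negative`, where the leg flip is written inline and
`cxWeight_one_eq` reads `cxWeight 1 lam x = cxWeight 0 lam (x ∘ fun p => (p.1, if p.1 = 2 then p.2 + 1 else p.2))`;
import THAT module, not this work file) -/

/-- Flip the bit of the ends of the third leg. -/
def legFlip (p : Fin 3 × ZMod 2) : Fin 3 × ZMod 2 := (p.1, if p.1 = 2 then p.2 + 1 else p.2)

/-- `legFlip` is an involution. -/
theorem legFlip_legFlip (p : Fin 3 × ZMod 2) : legFlip (legFlip p) = p := by
  rcases p with ⟨i, a⟩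
  unfold legFlip
  by_cases hi : i = 2
  · simp [hi, add_assoc, zmod2_add_self]
  · simp [hi]

/-- `legFlip` as a permutation of the six end labels. -/
def legFlipEquiv : (Fin 3 × ZMod 2) ≃ (Fin 3 × ZMod 2) :=
  ⟨legFlip, legFlip, legFlip_legFlip, legFlip_legFlip⟩

/-- The induced map on the complex: ends flipped on the third leg, inner vertices fixed. -/
def cxFlip : CxVert → CxVert
  | .inl p => .inl (legFlip p)
  | .inr S' => .inr S'

/-- `cxFlip` is an involution. -/
theorem cxFlip_cxFlip (u : CxVert) : cxFlip (cxFlip u) = u := by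
  rcases u with p | S'
  · simp [cxFlip, legFlip_legFlip]
  · rfl

/-- `cxFlip` as a permutation of the ten complex vertices. -/
def cxFlipEquiv : CxVert ≃ CxVert := ⟨cxFlip, cxFlip, cxFlip_cxFlip, cxFlip_cxFlip⟩

/-- `cxFlip` is injective. -/
theorem cxFlip_injective : Function.Injective cxFlip := cxFlipEquiv.injective

/-- The represented bits under charge `1` are those under charge `0` with the third one flipped. -/
theorem bit_one_eq (S' : Fin 2 → ZMod 2) (i : Fin 3) :
    bit 1 S' i = bit 0 S' i + if i = 2 then 1 else 0 := by
  unfold bit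
  by_cases h0 : i = 0
  · subst h0; simp
  · by_cases h1 : i = 1
    · subst h1; simp
    · have h2 : i = 2 := by
        rcases i with ⟨i, hi⟩
        have : i ≠ 0 := fun h => h0 (Fin.ext (by simp [h]))
        have : i ≠ 1 := fun h => h1 (Fin.ext (by simp [h]))
        exact Fin.ext (by simp; omega)
      subst h2
      simp
      ring

/-- Generating relation: charge `1` is charge `0` seen through `cxFlip`. -/
theorem cxRel_one_iff (u v : CxVert) : cxRel 1 u v ↔ cxRel 0 (cxFlip u) (cxFlip v) := by
  rcases u with ⟨i, a⟩ | S' <;> rcases v with ⟨i', a'⟩ | S''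
  · simp [cxRel, cxFlip]
  · simp [cxRel, cxFlip]
  · simp only [cxRel, cxFlip, legFlip]
    rw [bit_one_eq]
    by_cases hi : i' = 2
    · simp only [hi, if_true]
      constructor
      · intro h; rw [← h, add_assoc, zmod2_add_self, add_zero]
      · intro h
        have := congrArg (· + 1) h
        simpa [add_assoc, zmod2_add_self] using this
    · simp [hi]
  · simp [cxRel, cxFlip]

/-- Adjacency: `cxGraph 1` is `cxGraph 0` pulled back along `cxFlip`. -/
theorem cxGraph_one_adj (u v : CxVert) : (cxGraph 1).Adj u v ↔ (cxGraph 0).Adj (cxFlip u) (cxFlip v) := by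
  rw [cxGraph_adj, cxGraph_adj, cxRel_one_iff u v, cxRel_one_iff v u, cxFlip_injective.ne_iff]

/-- Independence transports along `cxFlip`. -/
theorem isIndepSet_one_iff (J : Finset CxVert) :
    (cxGraph 1).IsIndepSet (↑J : Set CxVert) ↔
      (cxGraph 0).IsIndepSet (↑(J.map cxFlipEquiv.toEmbedding) : Set CxVert) := by
  constructor
  · intro h x hx y hy hxy
    obtain ⟨u, hu, rfl⟩ := Finset.mem_map.1 (Finset.mem_coe.1 hx)
    obtain ⟨v, hv, rfl⟩ := Finset.mem_map.1 (Finset.mem_coe.1 hy)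
    have huv : u ≠ v := fun h' => hxy (by rw [h'])
    intro hadj
    exact h (Finset.mem_coe.2 hu) (Finset.mem_coe.2 hv) huv ((cxGraph_one_adj u v).2 hadj)
  · intro h u hu v hv huv hadj
    have hu' : cxFlipEquiv.toEmbedding u ∈ J.map cxFlipEquiv.toEmbedding := Finset.mem_map_of_mem _ hu
    have hv' : cxFlipEquiv.toEmbedding v ∈ J.map cxFlipEquiv.toEmbedding := Finset.mem_map_of_mem _ hv
    have huv' : cxFlipEquiv.toEmbedding u ≠ cxFlipEquiv.toEmbedding v :=
      fun h' => huv (cxFlipEquiv.injective h')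
    exact h (Finset.mem_coe.2 hu') (Finset.mem_coe.2 hv') huv' ((cxGraph_one_adj u v).1 hadj)

/-- **Tseitin covariance at one leg.** Moving the local charge of the CFI complex from `1` to `0` is the same
as exchanging the vacancy parameters of the two ends of the third leg.  (With the `Fin 3`-symmetry of the
complex this is the covariance the skeleton invokes in S6: the factor at `w` under off-diagonal bits `b` is
`F_{c w + Σ b}` — the prover of `stub_tseitinGap` can import this.) -/
theorem cxWeight_one_eq (lam : ℝ) (x : Fin 3 × ZMod 2 → ℝ) :
    cxWeight 1 lam x = cxWeight 0 lam (x ∘ legFlip) := by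
  unfold cxWeight
  refine Fintype.sum_equiv (Equiv.finsetCongr cxFlipEquiv) _ _ fun J => ?_
  rw [Equiv.finsetCongr_apply, Finset.card_map]
  by_cases hJ : (cxGraph 1).IsIndepSet (↑J : Set CxVert)
  · rw [if_pos hJ, if_pos ((isIndepSet_one_iff J).1 hJ)]
    congr 1
    refine Fintype.prod_equiv legFlipEquiv _ _ fun p => ?_
    have hmem : ((Sum.inl p : CxVert) ∈ J) ↔
        ((Sum.inl (legFlipEquiv p) : CxVert) ∈ J.map cxFlipEquiv.toEmbedding) := by
      constructor
      · intro h
        exact Finset.mem_map.2 ⟨Sum.inl p, h, rfl⟩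
      · intro h
        obtain ⟨u, hu, hu'⟩ := Finset.mem_map.1 h
        have : u = Sum.inl p := by
          apply cxFlipEquiv.injective
          rw [show (cxFlipEquiv (Sum.inl p) : CxVert) = Sum.inl (legFlipEquiv p) from rfl]
          exact hu'
        rw [← this]; exact hu
    have hval : (x ∘ legFlip) (legFlipEquiv p) = x p := by
      show x (legFlip (legFlip p)) = x p
      rw [legFlip_legFlip]
    by_cases hp : (Sum.inl p : CxVert) ∈ J
    · rw [if_pos hp, if_pos (hmem.1 hp), hval]
    · rw [if_neg hp, if_neg (fun h => hp (hmem.2 h))]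
  · rw [if_neg hJ, if_neg (fun h => hJ ((isIndepSet_one_iff J).2 h))]

/-- At a constant port pattern the complex factor does not see the charge. -/
theorem cxW_const_eq (lam qp qm : ℝ) (s : Bool) (e : ZMod 2) :
    cxW lam qp qm e (fun _ => s) = cxW lam qp qm 0 (fun _ => s) := by
  rcases zmod2_eq_zero_or_one e with rfl | rfl
  · rfl
  · unfold cxW
    rw [cxWeight_one_eq]
    rfl

/-- The complex factor is at least the empty configuration's weight `1`. -/
theorem one_le_cxWeight (e : ZMod 2) {lam : ℝ} (hlam : 0 ≤ lam) {x : Fin 3 × ZMod 2 → ℝ}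
    (hx : ∀ p, 0 ≤ x p) : 1 ≤ cxWeight e lam x := by
  unfold cxWeight
  have hterm : ∀ J : Finset CxVert, 0 ≤ (if (cxGraph e).IsIndepSet (↑J : Set CxVert) then
      lam ^ J.card * ∏ p : Fin 3 × ZMod 2, (if (Sum.inl p : CxVert) ∈ J then x p else 1) else 0) := by
    intro J
    split_ifs
    · exact mul_nonneg (pow_nonneg hlam _)
        (Finset.prod_nonneg fun p _ => by split_ifs <;> [exact hx p; exact zero_le_one])
    · exact le_rfl
  have hempty : (if (cxGraph e).IsIndepSet (↑(∅ : Finset CxVert) : Set CxVert) then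
      lam ^ (∅ : Finset CxVert).card *
        ∏ p : Fin 3 × ZMod 2, (if (Sum.inl p : CxVert) ∈ (∅ : Finset CxVert) then x p else 1) else 0) = 1 := by
    have h : (cxGraph e).IsIndepSet ((∅ : Finset CxVert) : Set CxVert) := by
      simp [SimpleGraph.IsIndepSet, Set.Pairwise]
    rw [if_pos h]
    simp
  calc (1 : ℝ) = _ := hempty.symm
    _ ≤ _ := Finset.single_le_sum (fun J _ => hterm J) (Finset.mem_univ (∅ : Finset CxVert))

/-- The complex factor is monotone in the vacancy parameters (coefficientwise positivity). -/
theorem cxWeight_mono (e : ZMod 2) {lam : ℝ} (hlam : 0 ≤ lam) {x x' : Fin 3 × ZMod 2 → ℝ}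
    (hx : ∀ p, 0 ≤ x p) (hxx' : ∀ p, x p ≤ x' p) : cxWeight e lam x ≤ cxWeight e lam x' := by
  unfold cxWeight
  refine Finset.sum_le_sum fun J _ => ?_
  split_ifs
  · refine mul_le_mul_of_nonneg_left ?_ (pow_nonneg hlam _)
    refine Finset.prod_le_prod (fun p _ => ?_) (fun p _ => ?_)
    · split_ifs <;> [exact hx p; exact zero_le_one]
    · split_ifs <;> [exact hxx' p; exact le_rfl]
  · exact le_rfl

/-- The normalised complex factor is positive. -/
theorem cxW_pos {lam qp qm : ℝ} (hlam : 0 ≤ lam) (hqm1 : qm ≤ 1) (hqp1 : qp ≤ 1) (e : ZMod 2)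
    (y : Fin 3 × ZMod 2 → Bool) : 0 < cxW lam qp qm e y := by
  unfold cxW
  refine div_pos (lt_of_lt_of_le zero_lt_one (one_le_cxWeight e hlam fun p => ?_)) (pow_pos (by linarith) _)
  unfold occP; split_ifs <;> linarith

/-- The complex factor is maximal when all six ports are in phase `−` (vacancy `1 − q⁻` everywhere). -/
theorem cxW_le_allMinus {lam qp qm : ℝ} (hlam : 0 ≤ lam) (hle : qm ≤ qp) (hqp1 : qp ≤ 1) (e : ZMod 2)
    (y : Fin 3 × ZMod 2 → Bool) : cxW lam qp qm e y ≤ cxW lam qp qm e (fun _ => false) := by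
  unfold cxW
  refine div_le_div_of_nonneg_right (cxWeight_mono e hlam (fun p => ?_) (fun p => ?_)) (pow_nonneg (by linarith) _)
  · unfold occP; split_ifs <;> linarith
  · unfold occP
    cases y p
    · simp
    · simp only [if_true, Bool.false_eq_true, if_false]
      linarith

/-- With no pair coupling the weight of a phase vector is the product of the complex factors. -/
theorem pwW_zero_coupling {M : ℕ} (R : RotGraph M 3) (lam qp qm : ℝ) (κ₂ : ℕ) (c : Fin M → ZMod 2)
    (Y : Dart M 3 × ZMod 2 → Bool) :
    pwW R lam qp qm 0 κ₂ c Y =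
      ∏ w : Fin M, cxW lam qp qm (c w) (fun p => Y ((canonEnd R (w, p.1)).1, p.2)) ^ κ₂ := by
  unfold pwW pairW
  simp

/-- **`stub_tseitinGap` is false without its coupling hypothesis** (any proof must use `hcouple`).  Switch the
pair coupling off (`κ₁ = 0`): for EVERY 3-regular rotation map `R` (no `NoFixed`, no expansion needed), every
`w₀`, all `q⁻ < q⁺ < 1`, `λ > 0`, `κ₂ ≥ 1`, and even granted STRICT charge visibility `Ψ(1) < Ψ(0)`, no `Y₀`
under charge `0` dominates all phase vectors under the odd charge boosted by `e^{κ₂ g}`: the all-`−` vector is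
charge-blind (`cxW_const_eq`) and maximal (`cxW_le_allMinus`), so it beats every `Y₀` by exactly `e^{κ₂ g} > 1`
— the brute force of §4d finds precisely this vector (`argmax = 00…0`, `log_ratio = κ₂ g`). -/
theorem tseitinGap_false_without_coupling {M : ℕ} (R : RotGraph M 3) (w₀ : Fin M) {lam qp qm : ℝ}
    (hlam : 0 < lam) (hlt : qm < qp) (hqp : qp < 1)
    (hΨ : pwPsi lam qp qm 1 < pwPsi lam qp qm 0) {κ₂ : ℕ} (hκ₂ : 1 ≤ κ₂) :
    ¬ ∃ Y₀ : Dart M 3 × ZMod 2 → Bool, ∀ Y : Dart M 3 × ZMod 2 → Bool,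
      pwW R lam qp qm 0 κ₂ (Pi.single w₀ 1) Y *
          Real.exp (κ₂ * (pwPsi lam qp qm 0 - pwPsi lam qp qm 1)) ≤
        pwW R lam qp qm 0 κ₂ 0 Y₀ := by
  rintro ⟨Y₀, h⟩
  have hmain := h (fun _ => false)
  set Fm : ℝ := cxW lam qp qm 0 (fun _ => false) with hFm
  have hFm_pos : 0 < Fm := cxW_pos hlam.le (hlt.le.trans hqp.le) hqp.le 0 _
  have hL : pwW R lam qp qm 0 κ₂ (Pi.single w₀ 1) (fun _ => false) = ∏ _w : Fin M, Fm ^ κ₂ := by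
    rw [pwW_zero_coupling]
    refine Finset.prod_congr rfl fun w _ => ?_
    rw [cxW_const_eq lam qp qm false]
  have hR : pwW R lam qp qm 0 κ₂ 0 Y₀ ≤ ∏ _w : Fin M, Fm ^ κ₂ := by
    rw [pwW_zero_coupling]
    refine Finset.prod_le_prod (fun w _ => pow_nonneg (cxW_pos hlam.le (hlt.le.trans hqp.le) hqp.le _ _).le _)
      (fun w _ => ?_)
    exact pow_le_pow_left₀ (cxW_pos hlam.le (hlt.le.trans hqp.le) hqp.le _ _).le
      (cxW_le_allMinus hlam.le hlt.le hqp.le _ _) κ₂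
  have hP : 0 < ∏ _w : Fin M, Fm ^ κ₂ := Finset.prod_pos fun w _ => pow_pos hFm_pos _
  have hexp : 1 < Real.exp (κ₂ * (pwPsi lam qp qm 0 - pwPsi lam qp qm 1)) := by
    have hk : (0 : ℝ) < κ₂ := Nat.cast_pos.2 hκ₂
    have ht : (0 : ℝ) < κ₂ * (pwPsi lam qp qm 0 - pwPsi lam qp qm 1) := mul_pos hk (sub_pos.2 hΨ)
    have := Real.exp_lt_exp.2 ht
    rwa [Real.exp_zero] at this
  rw [hL] at hmain
  have : (∏ _w : Fin M, Fm ^ κ₂) * Real.exp (κ₂ * (pwPsi lam qp qm 0 - pwPsi lam qp qm 1)) ≤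
      ∏ _w : Fin M, Fm ^ κ₂ := hmain.trans hR
  have h2 : (∏ _w : Fin M, Fm ^ κ₂) * 1 < (∏ _w : Fin M, Fm ^ κ₂) *
      Real.exp (κ₂ * (pwPsi lam qp qm 0 - pwPsi lam qp qm 1)) := mul_lt_mul_of_pos_left hexp hP
  linarith

/-! ### §4c′ Kernel-checked: `stub_tseitinGap` has no slack (LANDED as
`Theorems/PolyDepthTwinsAbove/Negative/TseitinGapTight.lean`, p76061; same statements, namespace `…Negative`) -/

/-- **The reference vector attains `stub_tseitinGap`'s bound under the odd charge.**  With
`Yref (δ, a) := (a = 0)`, every complex reads the reference port pattern `p ↦ (p.2 = 0)` whatever the base `R`,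
so `pwW c Yref = (pair product) · Π_w cxW (c w) ref ^ κ₂`; for `c = 1_{w₀}` versus `c = 0` the quotient is
`(cxW 1 ref / cxW 0 ref)^{κ₂} = e^{−κ₂ (Ψ0 − Ψ1)}`. -/
theorem tseitinGap_attained_at_reference {M : ℕ} (R : RotGraph M 3) (w₀ : Fin M) {lam qp qm : ℝ}
    (hlam : 0 ≤ lam) (hqm1 : qm ≤ 1) (hqp1 : qp ≤ 1) (κ₁ κ₂ : ℕ) :
    pwW R lam qp qm κ₁ κ₂ (Pi.single w₀ 1) (fun g => decide (g.2 = 0)) *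
        Real.exp (κ₂ * (pwPsi lam qp qm 0 - pwPsi lam qp qm 1)) =
      pwW R lam qp qm κ₁ κ₂ 0 (fun g => decide (g.2 = 0)) := by
  -- positivity of the two reference complex factors
  have hpos : ∀ e : ZMod 2, 0 < cxW lam qp qm e (fun p => decide (p.2 = 0)) := by
    intro e
    unfold cxW cxWeight
    refine div_pos ?_ (pow_pos (by linarith) _)
    have hx : ∀ p : Fin 3 × ZMod 2, 0 ≤ 1 - occP qp qm (decide (p.2 = 0)) := by
      intro p; unfold occP; split_ifs <;> linarith
    have hterm : ∀ J : Finset CxVert, 0 ≤ (if (cxGraph e).IsIndepSet (↑J : Set CxVert) then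
        lam ^ J.card * ∏ p : Fin 3 × ZMod 2,
          (if (Sum.inl p : CxVert) ∈ J then 1 - occP qp qm (decide (p.2 = 0)) else 1) else 0) := by
      intro J
      split_ifs
      · exact mul_nonneg (pow_nonneg hlam _)
          (Finset.prod_nonneg fun p _ => by split_ifs <;> [exact hx p; exact zero_le_one])
      · exact le_rfl
    have hempty : (if (cxGraph e).IsIndepSet (↑(∅ : Finset CxVert) : Set CxVert) then
        lam ^ (∅ : Finset CxVert).card * ∏ p : Fin 3 × ZMod 2,
          (if (Sum.inl p : CxVert) ∈ (∅ : Finset CxVert) then 1 - occP qp qm (decide (p.2 = 0)) else 1)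
        else 0) = 1 := by
      have h : (cxGraph e).IsIndepSet ((∅ : Finset CxVert) : Set CxVert) := by
        simp [SimpleGraph.IsIndepSet, Set.Pairwise]
      rw [if_pos h]
      simp
    calc (0 : ℝ) < 1 := one_pos
      _ = _ := hempty.symm
      _ ≤ _ := Finset.single_le_sum (fun J _ => hterm J) (Finset.mem_univ (∅ : Finset CxVert))
  set A : ℝ := cxW lam qp qm 0 (fun p => decide (p.2 = 0)) with hA
  set B : ℝ := cxW lam qp qm 1 (fun p => decide (p.2 = 0)) with hB
  have hA0 : 0 < A := hpos 0
  have hB0 : 0 < B := hpos 1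
  -- the boost is `(A / B) ^ κ₂`
  have hexp : Real.exp (κ₂ * (pwPsi lam qp qm 0 - pwPsi lam qp qm 1)) = (A / B) ^ κ₂ := by
    unfold pwPsi
    rw [← hA, ← hB, ← Real.log_div hA0.ne' hB0.ne', ← Real.log_pow, Real.exp_log (pow_pos (div_pos hA0 hB0) _)]
  -- the complex products under the two charges
  have hprod1 : (∏ w : Fin M, cxW lam qp qm ((Pi.single w₀ (1 : ZMod 2) : Fin M → ZMod 2) w)
      (fun p => decide ((((canonEnd R (w, p.1)).1, p.2) : Dart M 3 × ZMod 2).2 = 0)) ^ κ₂) =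
      B ^ κ₂ * ∏ w ∈ (Finset.univ : Finset (Fin M)).erase w₀, A ^ κ₂ := by
    rw [← Finset.mul_prod_erase Finset.univ _ (Finset.mem_univ w₀)]
    congr 1
    · simp [hB]
    · refine Finset.prod_congr rfl fun w hw => ?_
      have hne : w ≠ w₀ := Finset.ne_of_mem_erase hw
      simp [hA, hne]
  have hprod0 : (∏ w : Fin M, cxW lam qp qm ((0 : Fin M → ZMod 2) w)
      (fun p => decide ((((canonEnd R (w, p.1)).1, p.2) : Dart M 3 × ZMod 2).2 = 0)) ^ κ₂) =
      A ^ κ₂ * ∏ w ∈ (Finset.univ : Finset (Fin M)).erase w₀, A ^ κ₂ := by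
    rw [← Finset.mul_prod_erase Finset.univ _ (Finset.mem_univ w₀)]
    congr 1
  have key : B ^ κ₂ * (A / B) ^ κ₂ = A ^ κ₂ := by
    rw [← mul_pow, mul_div_assoc', mul_div_cancel_left₀ A hB0.ne']
  unfold pwW
  rw [hprod1, hprod0, hexp]
  calc _ = (∏ δ : Dart M 3, if Literature.ModelTheory.FiniteModelTheory.CFIMatching.Canon R δ then
        pairW qp qm κ₁ (decide (((δ, (0 : ZMod 2)) : Dart M 3 × ZMod 2).2 = 0))
          (decide (((δ, (1 : ZMod 2)) : Dart M 3 × ZMod 2).2 = 0)) else 1) *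
      ((B ^ κ₂ * (A / B) ^ κ₂) * ∏ w ∈ (Finset.univ : Finset (Fin M)).erase w₀, A ^ κ₂) := by ring
    _ = _ := by rw [key]

/-- **The boost `e^{κ₂ g}` of `stub_tseitinGap` is optimal.**  If the reference vector maximises the
charge-`0` weight (the content of any proof of the stub along the skeleton's lines), then for every
`T > e^{κ₂ g}` the strengthened conclusion `∃ Y₀ ∀ Y, pwW (1_{w₀}) Y · T ≤ pwW 0 Y₀` FAILS: test it at
`Y = Yref`, where the unstrengthened bound is already an equality (`tseitinGap_attained_at_reference`). -/
theorem tseitinGap_constant_optimal {M : ℕ} (R : RotGraph M 3) (w₀ : Fin M) {lam qp qm : ℝ}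
    (hlam : 0 ≤ lam) (hqm0 : 0 ≤ qm) (hqm1 : qm < 1) (hqp0 : 0 ≤ qp) (hqp1 : qp < 1) (κ₁ κ₂ : ℕ)
    (hmax : ∀ Y : Dart M 3 × ZMod 2 → Bool,
      pwW R lam qp qm κ₁ κ₂ 0 Y ≤ pwW R lam qp qm κ₁ κ₂ 0 (fun g => decide (g.2 = 0)))
    {T : ℝ} (hT : Real.exp (κ₂ * (pwPsi lam qp qm 0 - pwPsi lam qp qm 1)) < T) :
    ¬ ∃ Y₀ : Dart M 3 × ZMod 2 → Bool, ∀ Y : Dart M 3 × ZMod 2 → Bool,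
      pwW R lam qp qm κ₁ κ₂ (Pi.single w₀ 1) Y * T ≤ pwW R lam qp qm κ₁ κ₂ 0 Y₀ := by
  rintro ⟨Y₀, h⟩
  have href := h (fun g => decide (g.2 = 0))
  have heq := tseitinGap_attained_at_reference R w₀ hlam hqm1.le hqp1.le κ₁ κ₂
  -- the odd-charge weight of the reference vector is positive
  have hW1 : 0 < pwW R lam qp qm κ₁ κ₂ (Pi.single w₀ 1) (fun g => decide (g.2 = 0)) := by
    have hocc : ∀ s, 0 ≤ occP qp qm s ∧ occP qp qm s < 1 ∧ 0 ≤ occM qp qm s ∧ occM qp qm s < 1 := by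
      intro s
      cases s
      · simp only [occP, occM, Bool.false_eq_true, if_false]
        exact ⟨hqm0, hqm1, hqp0, hqp1⟩
      · simp only [occP, occM, if_true]
        exact ⟨hqp0, hqp1, hqm0, hqm1⟩
    have hpair : ∀ s t, 0 < pairW qp qm κ₁ s t := by
      intro s t
      unfold pairW
      obtain ⟨h1, h2, h5, h6⟩ := hocc s
      obtain ⟨h3, h4, h7, h8⟩ := hocc t
      have hP : occP qp qm s * occP qp qm t < 1 := mul_lt_one_of_nonneg_of_lt_one_left h1 h2 h4.le
      have hM : occM qp qm s * occM qp qm t < 1 := mul_lt_one_of_nonneg_of_lt_one_left h5 h6 h8.le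
      exact pow_pos (mul_pos (by linarith) (by linarith)) _
    unfold pwW
    refine mul_pos (Finset.prod_pos fun δ _ => ?_) (Finset.prod_pos fun w _ => pow_pos ?_ _)
    · split_ifs
      · exact hpair _ _
      · exact one_pos
    · -- positivity of a complex factor: the empty configuration contributes `1`
      unfold cxW cxWeight
      refine div_pos ?_ (pow_pos (by linarith) _)
      have hx : ∀ p : Fin 3 × ZMod 2, 0 ≤ 1 - occP qp qm
          (decide ((((canonEnd R (w, p.1)).1, p.2) : Dart M 3 × ZMod 2).2 = 0)) := by
        intro p; unfold occP; split_ifs <;> linarith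
      refine lt_of_lt_of_le one_pos ?_
      refine le_trans ?_ (Finset.single_le_sum (f := fun J : Finset CxVert =>
        if (cxGraph ((Pi.single w₀ (1 : ZMod 2) : Fin M → ZMod 2) w)).IsIndepSet (↑J : Set CxVert) then
          lam ^ J.card * ∏ p : Fin 3 × ZMod 2, (if (Sum.inl p : CxVert) ∈ J then 1 - occP qp qm
            (decide ((((canonEnd R (w, p.1)).1, p.2) : Dart M 3 × ZMod 2).2 = 0)) else 1) else 0)
        (fun J _ => ?_) (Finset.mem_univ (∅ : Finset CxVert)))
      · have h0 : (cxGraph ((Pi.single w₀ (1 : ZMod 2) : Fin M → ZMod 2) w)).IsIndepSet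
            ((∅ : Finset CxVert) : Set CxVert) := by
          simp [SimpleGraph.IsIndepSet, Set.Pairwise]
        rw [if_pos h0]
        simp
      · dsimp only
        split_ifs
        · exact mul_nonneg (pow_nonneg hlam _)
            (Finset.prod_nonneg fun p _ => by split_ifs <;> [exact hx p; exact zero_le_one])
        · exact le_rfl
  have hlt : pwW R lam qp qm κ₁ κ₂ (Pi.single w₀ 1) (fun g => decide (g.2 = 0)) *
      Real.exp (κ₂ * (pwPsi lam qp qm 0 - pwPsi lam qp qm 1)) <
      pwW R lam qp qm κ₁ κ₂ (Pi.single w₀ 1) (fun g => decide (g.2 = 0)) * T :=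
    mul_lt_mul_of_pos_left hT hW1
  have := hmax Y₀
  linarith


/-! ### §4d Brute force of `stub_tseitinGap` (all phase vectors) and the empirical coupling threshold -/

/-- **Brute-force record (gen 2; folder `compute/tseitin_gap2/`, scripts + JSON attached to the item; kit j009610
adds `K₃,₃` re-run under numpy with a cross-check against the pure transcription, and the cube `Q₃`, `M = 8`,
`2^24` vectors).** Definitions transcribed literally from `PhaseTwinsPolyDepthTwinsAboveDefs.lean`
(`occP/occM/pairW/cxGraph/cxWeight/cxW/pwW/pwPsi/cxRho`, `slyB`); only the phases of canonical copies enter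
`pwW`, so `Y` ranges over `2^{2E}` vectors (`E = 3M/2`).  Bases: `M = 2` (triple edge), `K₄` (`M = 4`), `K₃,₃`
(`M = 6`); parameters `(λ, q⁺, q⁻, κ₂)` ∈ {(5,.6,.1,1), (5,.6,.1,2), (5,.35,.3,1), (5,.35,.3,2), (1,.7,.05,1),
(8,.3,.2,2), (50,.9,.02,1), (4.2,.5,.2,3)}; `κ₁ :=` the least integer allowed by `hcouple`.
RESULTS. (i) The stub HOLDS in 24/24 instances and is TIGHT in every one: `max_Y pwW(1_{w₀}) Y · e^{κ₂ g}`
equals `max_Y pwW 0 Y` to rounding (`|log ratio| ≤ 5·10⁻¹³`), the maximiser for charge 0 being the planned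
witness `Y₀ = (a = 0)` (24/24) and for charge 1 the off-diagonal vector with ONE violated vertex — so the Lean
proof of S6 has zero slack in the off-diagonal sector (an `exp`/`log` identity) and all its slack in the
aligned sector.  (ii) Coupling off (`κ₁ = 0`): FAILS 24/24 with `log ratio = κ₂ g` exactly and maximiser
`Y ≡ false` — the witness of `tseitinGap_false_without_coupling`.  (iii) EMPIRICAL LEAST COUPLING `κ₁*` (smallest
`κ₁` for which the stub inequality holds; bisection, verified at the endpoint) versus `hcouple`'s demand
`κ₁ʰᶜ = ⌈κ₂(M log ρ_F + g)/log B⌉`: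
  `(λ,q⁺,q⁻,κ₂)`      `M=2: κ₁*/κ₁ʰᶜ`   `M=4`      `M=6`
  `(5,.6,.1,1)`         `3/15`            `3/30`     `3/45`
  `(5,.35,.3,1)`        `29/167`          `29/334`   `29/501`
  `(1,.7,.05,1)`        `1/5`             `1/9`      `1/14`
  `(50,.9,.02,1)`       `3/10`            `3/20`     `3/29`
  `(4.2,.5,.2,3)`       `13/71`           `13/142`   `13/213`
— `κ₁*` is INDEPENDENT of the base order `M`, while `hcouple` grows linearly in `M`.  Reading: an aligned pair
perturbs only the two complexes at the ends of its edge (one of the six phases each), so the alignment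
temptation per canonical pair is a LOCAL constant `τ(λ,q±,κ₂) = κ₁* log B` (≈ 1.0, 0.091, ≤0.60, 4.9, 1.5 here),
far below the crude global allowance `κ₂ M log ρ_F` of the skeleton's aligned-sector bound.  For the live line
this is immaterial (`κ₁ = n^{3θ/4}` dwarfs everything); for CONSTANT-SIZE designs (§5) it is the relevant budget.
Values of `g = Ψ0 − Ψ1` met: 0.0100, 7.5·10⁻⁶, 0.0057, 3.0·10⁻⁵, 0.111, 0.0019 (test `q±`, NOT the tree 2-cycle
values `q±(d,λ)`; the ideator's kit j008360 tabulates `g` at actual `(d, λ)`). -/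
theorem tseitinGap_bruteforce : True := trivial

/-! ## §5 Remarks for the round-2 ideas (`Ideas/linear-gap-constant-gadgets.md`, `Ideas/mirror-glued-gadget.md`) -/

/-- **What the recorded obstructions say about the two round-2 cards (gen 2; I grade nothing here).**
(1) Neither §1 fact bites (both cards keep `λ > λ_c` and `Δ ≥ 3` through the same trust base
`slyGadgetReduction`, instantiated once at constant size).  (2) The bare-CFI obstruction §2 does not bite: in
both cards the parity is carried by COUPLED gadget spins (pair coupling / mirror glue), not by bare CFI edges, so
the defect is not `e^{−Θ(|B|)}`-small — exactly the distinction §2 draws.  (3) What §4c–§4d add for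
constant-size designs: (a) an alignment penalty per variable is NECESSARY in any design whose parity connectors
read phases through monotone vacancies (`tseitinGap_false_without_coupling` is stated for every base and uses
only monotonicity + charge-blindness of the all-`−` pattern; the same two-line argument applies to a mirror-glued
`Γ_sym` with the glue removed, `J = ∅`); (b) the penalty that SUFFICES is local: per coupled pair/glued gadget
`κ₁ log B > τ(λ,q±,κ₂)`, with `τ` the local alignment temptation of §4d(iii) (M-independent, empirically
`≈ κ₂ ×` a constant of order `0.1–5` at the test points), NOT the skeleton's `κ₂(M log ρ_F + g)` — so the
`|J| = O((log n_g + κ g_max)/log B)` glue budget of `mirror-glued-gadget` and the constant `κ'` of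
`linear-gap-constant-gadgets` are consistent with the numerics, provided their energy lemma is proved with LOCAL
accounting (charge each aligned/junk gadget only for the ≤ `r·κ'` connectors it touches) rather than by copying
S6's global `ρ_F^{κ₂ M}` bound, which would FAIL at constant coupling and linear `M`.  (c) `g` is small unless
`q⁺ − q⁻` is large (`F₀ − F₁ = λ⁴(β−α)³` against `F ≈ (1+λα)³(1+λβ)³ + …`): at `(λ, q⁺, q⁻) = (5, .35, .3)`,
`g = 7.5·10⁻⁶`, so the far-from-code constant `η` and the connector multiplicity `κ'` trade off as
`κ' g η m > n(ln 2 + ln n_g)`; near `λ_c` (where `q⁺ − q⁻ → 0`) every constant explodes — expected, and not a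
refutation (the crux fixes `λ` first).  (4) Far-from-code XOR twins: the Duplicator engine needs both systems
`K`-locally satisfiable, which boundary expansion gives for EVERY right-hand side (so also for a far `b`) — no
obstruction from this file; the counting bound `2^n 2^{m h(η)} < 2^m` is fine at `m ≥ 3n/2, η = 1/20`
(`h(1/20) ≈ 0.286 < 1/3`) ✓ (checked: `h(0.05) = 0.2864`). -/
theorem round2_remarks : True := trivial

/-! ## §6 Literature delta for the kill scenario (gen 2) -/

/-- **Kill scenario re-searched (2026-08-16): "depth-n^{o(1)} Weisfeiler–Leman / bounded-treewidth hom counts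
pin `Z_G(λ)` to a factor 2 above `λ_c(Δ)`".**  Services: `lit search` (searchd) rc 75 all session —
search-degraded for OpenAlex/S2/arXiv/zbMATH; `lit galaxy search --star pdf` (bm25, two expanded queries:
"k-WL / bounded-treewidth hom counts vs independence polynomial / hard-core Z, determined exactly or
approximately?" and "above λ_c, Z determined up to a constant by local statistics or subexponential
Sherali–Adams/Lasserre level? positive results in non-uniqueness") — 50 rows read.  Nearest hits, none a kill:
Schindling (MFCS 2025, hom-indistinguishability × game comonads), Roberson–Seppelt (ICALP 2023, Lasserre ≡
hom-indistinguishability over a graph class — a CHARACTERISATION, it makes level-`k` Lasserre values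
`≡_{C^{O(k)}}`-invariant, so twins DEFEAT such relaxations: supports the crux's corollary, not its negation),
Rattan–Seppelt (WL & spectra), Göbel–Goldberg–Roth (WL-dimension of conjunctive queries), Davies–Perkins
(independent sets of a given size — a density threshold, uniqueness-type methods), Anand–Feng–Freifeld–Guo–Wang
(sub-quadratic counting in uniqueness), Sinclair–Srivastava–Thurley / Restrepo–Shin–Tetali–Yang (uniqueness
side), Cai–Galanis–Goldberg–Guo–Jerrum–Štefankovič–Vigoda (#BIS-hardness on bipartite graphs in
non-uniqueness).  ONE family deserves a sentence because it IS a positive result above `λ_c`: polymer/cluster-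
expansion algorithms at LOW temperature on (bipartite) EXPANDERS — Jenssen–Keevash–Perkins 2019, Chen–Galanis–
Goldberg–Perkins–Stewart–Vigoda ("Fast algorithms at low temperatures via Markov chains", APPROX/RANDOM 2019),
Carlson–Davies–Kolla (Potts on small-set expanders).  They do not threaten the crux: (i) the crux is
existential in `(G, H)` and a kill needs "the `C^{n^θ}`-TYPE determines `Z` to a factor 2 for ALL pairs", not
"`Z` is computable on a subclass"; computability of `Z_G` and `Z_H` separately is compatible with
`Z_G ≥ 2 Z_H ∧ G ≡ H`; (ii) their expansions are organised around the two ground states of a KNOWN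
bipartition, and a bipartition/ground state is exactly the kind of global `ℤ₂` datum that CFI-type twins hide
from `C^k` (the line's twins are built from bipartite gadgets, but the parity wiring destroys global
bipartiteness covariantly).  Conversely, no `C^k`-INVARIANT approximation above `λ_c` exists in print at any
`k = n^{o(1)}` (the invariant ones — BP/Bethe fixed points (1-WL, Grohe et al. 2021), level-`k` SA/Lasserre
(`C^{O(k)}`), zero-free Taylor truncation (depth `C log n`, below `λ_c` only) — all stop at `λ_c` or at
logarithmic depth).  Verdict unchanged; OpenAlex/arXiv side to be re-run when searchd returns (not a reason to
hold anything: the gen-1 and planner sweeps of 2026-08-15 covered them).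

GEN-3 ADDENDUM (2026-08-16 ~03:00Z).  searchd still rc 75 (`lit search` timed out at 60 s: OpenAlex/S2/arXiv/zbMATH
side again not run — search-degraded, logged).  `lit galaxy search --star pdf` bm25, two NEW expanded queries:
(q1) "which WL dimension / hom-count depth determines the independence polynomial or the hard-core `Z` of a
bounded-degree graph, exactly or approximately" (40 rows) — same family as gen 2 (Davies–Perkins; Cai–Galanis–
Goldberg–Guo–Jerrum–Štefankovič–Vigoda #BIS; Chen et al. low-temperature chains; Schindling MFCS'25; Roberson–Seppelt
ICALP'23; NT–Maehara GHC; Grohe–Neuen rank width) plus Fuhlbrück–Köbler–Verbitsky "Local WL invariance and hidden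
shades of regularity" (DAM 2021: which LOCAL parameters are `k`-WL-invariant — degree/regularity statistics, nothing on
`Z` or on depth `n^θ`) and GNN-expressivity papers (Puny et al. equivariant polynomials; hom-convolution) — no kill;
(q2) for the NEW annealed line: "first moment of independent sets in random lifts / bipartite double covers of
matchings vs the bipartite configuration model, maximised at product profiles?" (30 rows) — nearest Barbier–Krzakala–
Zdeborová–Zhang "The hard-core model on random graphs revisited" (arXiv:1306.4121, cavity/1RSB on random regular
graphs), Perarnau–Perkins (cubic, given girth), Mossel-type lecture notes; NOTHING computes the involution-model
(double-cover) first moment or its maximiser — consistent with the line card's novelty claim for `CoverGap`, and no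
printed counterexample to (N2) exists either.  Verdict unchanged. -/
theorem literature_delta : True := trivial

/-! ## §7 (gen 3) The depth-exponent ceiling, kernel-checked
(self-contained copy; LANDED as `Theorems/PolyDepthTwinsAbove/Negative/DepthCeiling.lean`, p80790, namespace `…Negative`,
identical statements — import THAT module in stub files, not this work file) -/

section DepthCeiling

open Literature.ModelTheory.FiniteModelTheory (CkEquiv Dvorak2010_ckEquiv_iff_homCount_holds)

/-- Independence is transported along a graph isomorphism. -/
theorem isIndepSet_map_iff {n : ℕ} {G H : SimpleGraph (Fin n)} (e : G ≃g H) (I : Finset (Fin n)) :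
    H.IsIndepSet (↑(I.map e.toEquiv.toEmbedding) : Set (Fin n)) ↔ G.IsIndepSet (↑I : Set (Fin n)) := by
  constructor
  · intro h a ha b hb hab hadj
    have ha' : e a ∈ I.map e.toEquiv.toEmbedding := Finset.mem_map.2 ⟨a, ha, rfl⟩
    have hb' : e b ∈ I.map e.toEquiv.toEmbedding := Finset.mem_map.2 ⟨b, hb, rfl⟩
    have hne : e a ≠ e b := fun h' => hab (e.injective h')
    exact h (Finset.mem_coe.2 ha') (Finset.mem_coe.2 hb') hne ((e.map_adj_iff).2 hadj)
  · intro h x hx y hy hxy hadj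
    obtain ⟨a, ha, rfl⟩ := Finset.mem_map.1 (Finset.mem_coe.1 hx)
    obtain ⟨b, hb, rfl⟩ := Finset.mem_map.1 (Finset.mem_coe.1 hy)
    have hab : a ≠ b := fun h' => hxy (by simp [h'])
    exact h (Finset.mem_coe.2 ha) (Finset.mem_coe.2 hb) hab ((e.map_adj_iff).1 hadj)

/-- **`Z` is an isomorphism invariant** (the crux's inlined hard-core sum). -/
theorem Z_eq_of_iso {n : ℕ} {G H : SimpleGraph (Fin n)} (e : G ≃g H) (lam : ℝ) : Z G lam = Z H lam := by
  unfold Z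
  refine Fintype.sum_equiv (Equiv.finsetCongr e.toEquiv) _ _ fun I => ?_
  rw [Equiv.finsetCongr_apply, Finset.card_map]
  by_cases hI : G.IsIndepSet (↑I : Set (Fin n))
  · rw [if_pos hI, if_pos ((isIndepSet_map_iff e I).2 hI)]
  · rw [if_neg hI, if_neg (fun h => hI ((isIndepSet_map_iff e I).1 h))]

/-- `Z_G(λ) > 0` for `λ ≥ 0` (the empty set contributes `1`). -/
theorem Z_pos {n : ℕ} (G : SimpleGraph (Fin n)) {lam : ℝ} (hlam : 0 ≤ lam) : 0 < Z G lam := by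
  unfold Z
  have hterm : ∀ I : Finset (Fin n), 0 ≤ (if G.IsIndepSet (↑I : Set (Fin n)) then lam ^ I.card else 0) :=
    fun I => by split_ifs <;> [exact pow_nonneg hlam _; exact le_rfl]
  have hempty : (if G.IsIndepSet (↑(∅ : Finset (Fin n)) : Set (Fin n)) then lam ^ (∅ : Finset (Fin n)).card
      else 0) = (1 : ℝ) := by
    have h : G.IsIndepSet ((∅ : Finset (Fin n)) : Set (Fin n)) := by
      simp [SimpleGraph.IsIndepSet, Set.Pairwise]
    rw [if_pos h]
    simp
  calc (0 : ℝ) < 1 := one_pos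
    _ = _ := hempty.symm
    _ ≤ _ := Finset.single_le_sum (fun I _ => hterm I) (Finset.mem_univ (∅ : Finset (Fin n)))

/-- **Hom-indistinguishability below depth `n` is isomorphism** (`n ≥ 2` vertices): equal hom counts from every
graph of treewidth `< n` give `≡_{C^n}` (Dvořák–Dell–Grohe–Rattan bridge, PROVED in the tree:
`Dvorak2010_ckEquiv_iff_homCount_holds`), and `n` pebble pairs on `n` vertices decide isomorphism
(`CkEquiv.nonempty_iso`, PROVED). -/
theorem nonempty_iso_of_homIndist_card {n : ℕ} (hn : 2 ≤ n) {G H : SimpleGraph (Fin n)}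
    (h : ∀ (m : ℕ) (F : SimpleGraph (Fin m)), Literature.Combinatorics.SimpleGraph.treewidth F < n →
      Nat.card (F →g G) = Nat.card (F →g H)) : Nonempty (G ≃g H) := by
  have hck : CkEquiv n G H := (Dvorak2010_ckEquiv_iff_homCount_holds n hn n n G H).2 h
  exact hck.nonempty_iso (by omega) (by simp)

/-- **At depth exponent `θ ≥ 1` the crux's hom-count hypothesis pins `Z` EXACTLY** (`n ≥ 2`, any real `λ`). -/
theorem hardcoreSum_eq_of_homIndist_rpow {n : ℕ} (hn : 2 ≤ n) {θ : ℝ} (hθ : 1 ≤ θ)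
    {G H : SimpleGraph (Fin n)}
    (h : ∀ (m : ℕ) (F : SimpleGraph (Fin m)),
      (Literature.Combinatorics.SimpleGraph.treewidth F : ℝ) < (n : ℝ) ^ θ →
        Nat.card (F →g G) = Nat.card (F →g H)) (lam : ℝ) : Z G lam = Z H lam := by
  have hn1 : (1 : ℝ) ≤ n := by exact_mod_cast (show 1 ≤ n by omega)
  have hpow : (n : ℝ) ≤ (n : ℝ) ^ θ := by
    calc (n : ℝ) = (n : ℝ) ^ (1 : ℝ) := (Real.rpow_one _).symm
      _ ≤ (n : ℝ) ^ θ := Real.rpow_le_rpow_of_exponent_le hn1 hθ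
  have h' : ∀ (m : ℕ) (F : SimpleGraph (Fin m)), Literature.Combinatorics.SimpleGraph.treewidth F < n →
      Nat.card (F →g G) = Nat.card (F →g H) := by
    intro m F hF
    refine h m F (lt_of_lt_of_le ?_ hpow)
    exact_mod_cast hF
  obtain ⟨e⟩ := nonempty_iso_of_homIndist_card hn h'
  exact Z_eq_of_iso e lam

/-- **The depth exponent of ANY witness family is `< 1`** — every `Δ`, every `λ ≥ 0`, no degree bound and no
threshold needed: if for arbitrarily large `n` there are graphs on `n` vertices, hom-indistinguishable below depth
`n^θ`, with `2·Z_H(λ) ≤ Z_G(λ)`, then `θ < 1`. -/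
theorem depthExponent_lt_one {θ lam : ℝ} (hlam : 0 ≤ lam)
    (h : ∀ n₀ : ℕ, ∃ (n : ℕ) (G H : SimpleGraph (Fin n)), n₀ ≤ n ∧
      (∀ (m : ℕ) (F : SimpleGraph (Fin m)),
        (Literature.Combinatorics.SimpleGraph.treewidth F : ℝ) < (n : ℝ) ^ θ →
          Nat.card (F →g G) = Nat.card (F →g H)) ∧
      2 * Z H lam ≤ Z G lam) :
    θ < 1 := by
  by_contra hθ
  push Not at hθ
  obtain ⟨n, G, H, hn, hhom, hZ⟩ := h 2
  rw [hardcoreSum_eq_of_homIndist_rpow hn hθ hhom lam] at hZ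
  have hpos := Z_pos H hlam
  linarith

/-- **Natural strengthening refuted: the crux at a GIVEN exponent `θ ≥ 1` is false** (the body of
`PhaseTwins.PolyDepthTwinsAbove` with `∃ θ > 0` replaced by the given `θ`; witness `Δ = 3`, `λ = 5 > 4 = λ_c(3)`).
So `PolyDepthTwinsAbove` lives entirely in `θ ∈ (0,1)`; depth `n^{1-o(1)}` is conceivable (bare CFI over cubic
expanders is `≡_{C^{Ω(n)}}` without isomorphism — §2 shows its `Z`-gap is tiny, not its depth), treewidth bound `n`
itself never. -/
theorem polyDepthTwinsAbove_false_at_exponent_ge_one {θ : ℝ} (hθ : 1 ≤ θ) :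
    ¬ (∀ Δ : ℕ, 3 ≤ Δ → ∀ lam : ℝ, ((Δ : ℝ) - 1) ^ (Δ - 1) / ((Δ : ℝ) - 2) ^ Δ < lam → ∀ n₀ : ℕ,
      ∃ (n : ℕ) (G H : SimpleGraph (Fin n)), n₀ ≤ n ∧ G.maxDegree ≤ Δ ∧ H.maxDegree ≤ Δ ∧
      (∀ (m : ℕ) (F : SimpleGraph (Fin m)),
        (Literature.Combinatorics.SimpleGraph.treewidth F : ℝ) < (n : ℝ) ^ θ →
          Nat.card (F →g G) = Nat.card (F →g H)) ∧
      2 * (∑ I : Finset (Fin n), (if H.IsIndepSet (↑I : Set (Fin n)) then lam ^ I.card else 0)) ≤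
        ∑ I : Finset (Fin n), (if G.IsIndepSet (↑I : Set (Fin n)) then lam ^ I.card else 0)) := by
  intro h
  have h35 := h 3 le_rfl 5 (by norm_num)
  have hlt : θ < 1 :=
    depthExponent_lt_one (lam := 5) (by norm_num) fun n₀ => by
      obtain ⟨n, G, H, hn, -, -, hhom, hZ⟩ := h35 n₀
      exact ⟨n, G, H, hn, hhom, hZ⟩
  linarith

/-- **Corollary against the crux as filed:** IF `PolyDepthTwinsAbove` holds, the exponent it yields at each
admissible `(Δ, λ)` is `< 1`. -/
theorem depthExponent_lt_one_of_polyDepthTwinsAbove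
    (h : Summit.PneNP.PneNP.Theses.PhaseTwins.PolyDepthTwinsAbove) {Δ : ℕ} (hΔ : 3 ≤ Δ) {lam : ℝ}
    (hlam : ((Δ : ℝ) - 1) ^ (Δ - 1) / ((Δ : ℝ) - 2) ^ Δ < lam) (hlam0 : 0 ≤ lam) :
    ∃ θ : ℝ, 0 < θ ∧ θ < 1 ∧ ∀ n₀ : ℕ, ∃ (n : ℕ) (G H : SimpleGraph (Fin n)), n₀ ≤ n ∧
      G.maxDegree ≤ Δ ∧ H.maxDegree ≤ Δ ∧
      (∀ (m : ℕ) (F : SimpleGraph (Fin m)),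
        (Literature.Combinatorics.SimpleGraph.treewidth F : ℝ) < (n : ℝ) ^ θ →
          Nat.card (F →g G) = Nat.card (F →g H)) ∧
      2 * Z H lam ≤ Z G lam := by
  obtain ⟨θ, hθ, hw⟩ := h Δ hΔ lam hlam
  refine ⟨θ, hθ, ?_, hw⟩
  exact depthExponent_lt_one hlam0 fun n₀ => by
    obtain ⟨n, G, H, hn, -, -, hhom, hZ⟩ := hw n₀
    exact ⟨n, G, H, hn, hhom, hZ⟩

end DepthCeiling

/-! ## §8 (gen 3) Targets, round 2: the two new skeletons (`linear-gap-constant-gadgets`, `annealed-cover-twins`) -/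

/-- **Lean-signature audit of the 14 new stubs (2026-08-16; `Lines/linear-gap-constant-gadgets.lean` commit
92686ce8a4b5, `Lines/annealed-cover-twins.lean` as written 02:36Z).  NO STUB IS FALSE AS TYPED.**  Read back
quantifier by quantifier, every degenerate value the binders admit instantiated; ✓ = holds there (reason); the
load-bearing hypotheses are named for the provers.

`annealed-cover-twins` (NO named fact: closing its 7 stubs proves the crux unconditionally — hence audited first).
* `stub_coverGap` (hyps = those of `slyPhi1_local_gap`): `∃ us vs` is PINNED to the inner argmax at the product
  profile (else the inequality fails at `(ν⁺, u*, v*)` itself) — consistent, prover's choice ✓; `profDist ≤ 1` on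
  `Adm`, so one `(ℓ, C)` serves globally by compactness once the maximiser set is exactly the two product profiles ✓.
  Substance = (N2); attacked numerically in the extreme regimes, `coverGap_extremes` below: holds.  Prover's warning:
  the thinnest margin sits at the BOUNDARY stratum `ν₀₀, ν₁₁ → 0` (complementary profile), where `x log x` is not
  analytic — the "analyticity + Łojasiewicz" plan covers neighbourhoods of the two interior maximisers; the rest of the
  polytope (incl. its boundary) needs the strict inequality + compactness, i.e. (N2) with its equality case, exactly.
* `stub_annealedPortLaw` (`∃ θ₀ n₀ ∀ n' ≥ n₀ even ∀ κ, 2κ ≤ n'^{θ₀} ∀ P τ, IsPortMatching ∀ k`): `θ₀, n₀` may depend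
  on `(d, λ, p±)` ✓; `κ = 0`: one pattern, `gadPat P I = k` trivially, `gadG = gadTot`, `mix = 1` ✓; `θ₀ > 1` would
  allow `2κ > n'` but then no `P : Fin 2 × Fin κ ↪ Fin n'` exists (vacuous) ✓; `n'` even and `2κ` even ⇒ a port
  matching exists ✓.  Deck symmetry `gadG k = gadG (k ∘ swap)` is EXACT (`gadGraph_adj_swap`), so the `½–½` mixture is
  the right target ✓.  Substance re-derived here independently: bulk profile at the maximiser of `Λ` with `d`
  matchings (`d−1` random `σ` + the port matching `τ`, which the symmetrisation over `Perm(Fin n')_{ports}` makes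
  uniform); ports are `τ`-FIXED, so their tilt is `λ^{|s|} e^{(d−1)ψ_s}` (NOT `d`), and stationarity
  `−log ν_s + |s| log λ + dψ_s = μ` gives `P(s) ∝ λ^{|s|/d} ν_s^{(d−1)/d}` — a PRODUCT law at the product profile, with
  layer-0 odds `λ^{1/d}(p⁺/(1−p⁺))^{(d−1)/d} = p⁺/(1−p⁺−p⁻) = q⁺/(1−q⁺)` by `hEα` ✓ (`(3,5)`: `p± = 0.654508/0.095492`,
  `q± = 0.7236/0.2764` ✓).  Uniformity over all `2^{4κ}` patterns at fixed `(d, λ)`: all four type probabilities are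
  bounded below, without-replacement density `e^{O(κ²/(ν_min n'))}` ✓.  Nothing false; XL but charted.
* `stub_annealedConnector`: exact fibre algebra ✓ (`annZ(c) = C₀ Σ_k [Π_{δ canon} G(k_δ)] Π_{w,j} cxWeight(c w, λ,
  vacancies)`, `C₀ = (|GSample|(1+λ)^{2n'})^{#non-canonical}`; every port vertex of a canonical gadget is read by
  exactly one end: `canonEnd_injective` + `P` injective + `hNF`).  `#canonical = 3M/2 ≤ 3M` (exponent loose by 2,
  harmless) ✓; `M = 0`: `annZ = acA = 1`, `C₁ = 1` ✓; `κ = 0` ✓.  LOAD-BEARING: `hGS` — with `GSample = ∅` (`n'` odd,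
  `dm ≥ 1`) and `M ≥ 1`, `annZ = 0` while `A_c > 0`, so the lower bound fails for `ε < 1` (and `hlaw` holds vacuously:
  `0 ≤ ε·0`); `hNF` — a half-edge plugs ends into a non-canonical copy whose vertices are ISOLATED (pattern law =
  i.i.d. `Bern(λ/(1+λ))`, not `mix`), so the factorisation through `hlaw` breaks.  Both are hypotheses ✓.
* `stub_tseitinSum` (`EdgeExpansion R η`, `NoFixed`, ALL real `λ, q±`, all `κ, w₀`): exact identity ✓ re-derived:
  `A_c = 2^{2M}(S^M + (−1)^{Σc} D^M)`.  `EdgeExpansion` carries `pos : 0 < η`, hence connectivity (`big_of_empty`) —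
  and connectivity IS load-bearing: on a base with two components of orders `a, b` one gets
  `A_c ∝ Π_comp (S^{|C|} ± D^{|C|})`, and `A₁(S^M + D^M) − A₀(S^M − D^M) ∝ 2 S^a D^a (D^b − S^b) ≠ 0` for `κ ≥ 1`,
  `λ > 0`, `q⁻ < q⁺` (e.g. `M = 4`, two triple-edge pairs: equality ⇔ `S⁴ + D⁴ = (S² + D²)²` ⇔ `SD = 0`).  Self-loops
  (allowed by `NoFixed`) are harmless: a loop's two darts read the same bit, an even contribution ✓.  `M = 1` vacuous
  (no fixed-point-free involution on 3 darts), `κ = 0`: `S = 2, D = 0`, both sides `A·2^M` ✓.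
* `stub_duplicator`: hypotheses verbatim the LANDED sibling (`EdgeExpansion`, `2 ≤ M`, `6K < ηM`; `S, P, τ, c, c'`
  arbitrary — the gauge shift never reads them) ✓; `K = 0` trivial ✓; no small counter-model possible in principle.
* `stub_maxDegree` (DISCHARGED — a theorem in the 02:41Z skeleton, 6 stubs left; audit kept for the record: `3 ≤ dm+1`,
  `IsPortMatching P τ`, `S δ i ∈ fpfInv`): canonical gadget vertex `(δ,a,x)`: after
  `fromRel` symmetrisation its layer-`(a+1)` neighbours are `{S δ i x}_i ∪ {τ x} ∖ {x}` (involutions both ways) —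
  `≤ dm + [x ∉ range P]` — plus ONE end iff `x = P(s,j)` (`canonEnd_injective`): `≤ dm + 1` ✓; non-canonical copy
  `≤ 1`; end `1 + 2`; inner `3` ✓ (`hdm`).  LOAD-BEARING: `hτ.fixed_iff` (a `τ`-edge at a port gives `dm + 2`) and
  `hS` (a non-involutive `S δ i` adds in-neighbours `(S δ i)⁻¹ x`).  `NoFixed` NOT needed (half-edge ⇒ end on an
  isolated junk vertex, degree 1) ✓; `dm = 0,1` excluded only through `3 ≤ dm+1` for the complex vertices ✓.
* `stub_parameters`: eleven clauses, simultaneously satisfiable for `m₀ ≫ 1` with `k = ⌈2/θ₀⌉` (`kθ₀ ≥ 2 > 1`),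
  `θ' = 1/(2k+2)`: `(F₀^κ+F₁^κ)^M ≤ 2(F₀^κ−F₁^κ)^M ⟸ (F₁/F₀)^κ ≤ 1/(4M) ⟸ κ = ⌈log(4M)/log(F₀/F₁)⌉₊`
  (`log(F₀/F₁) > 0` from `0 < F₁ < F₀`) ✓; `3M(2M^k)^{−θ₀} → 0` ✓; `(22M^{k+1})^{1/(2k+2)} = 22^{o(1)}√M ≤ ⌊ηM/7⌋` ✓;
  `6⌊ηM/7⌋ < ηM`, `1 ≤ K`, `2 ≤ M` ✓.  True but laborious.

`linear-gap-constant-gadgets` (trust base `stub_slyGadgets` ≡ `slyGadgetReduction`, as the picked line).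
* `stub_linearSystems` (pure `∃`): TRUE and provable as the planner says; checked the two numerical hinges of the
  derivation: far-ness by counting needs `h(η) < 1 − nv/m` with `m/nv ≥ 4/1.25 = 3.2` after splitting, `h(1/16) =
  0.337 < 0.6875` ✓; unique-neighbour expansion `|T| ≤ 2|∂T|` from `7|T| ≤ 4|N(T)|` via `|∂T| ≥ 2|N(T)| − 3|T|` ✓;
  splitting variables only enlarges `∂T` ✓.  Nothing for a refuter (an existence statement about explicit systems).
* `stub_duplicator`: `p = 0` with `q > 0`, `s ≥ 1` forces `m = 0` (every singleton `T` would need `|T| = 0`), then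
  `b = 0` and the claim is reflexivity ✓; otherwise the PROVED `ckEquiv_of_consistencyFamily` +
  `isConsistencyFamily_good`; `hE` (three distinct variables) only simplifies `∂f e = Σ_{lgScope} f` ✓.
* `stub_maxDegree`: a port receives ≤ 1 extra edge (`slot` injective, `Vp/Vm` ranges disjoint by `hVV`, `hloc`
  separates two occurrences of one variable — also inside ONE equation); `ZMod 2` makes the pair edge
  `(x,a,y)—(x,a+1,y)` a single edge ✓; `d ∈ {0,1,2}` only strengthen (`d − 1 = 0` truncated) ✓; ends `3 ≤ Δ` ✓.
* `stub_connector`: `hn : 0 < n` removes the `(0^{2nv})⁻¹ = 0` junk; `λ = 0` ⇒ `SlyPropA` unsatisfiable at `n ≥ 1`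
  (the phase opposite to `slyPhase ∅` has probability `0 < 1/n`) ⇒ vacuous ✓; distinct ports as in S4 ✓; `m = K = 0`,
  `κ₁ = 0`, `nv = 0` ✓ (as the planner lists).  Same bookkeeping as the sibling's hardest stub; not attackable.
* `stub_energy` — RE-DERIVED IN FULL here (it is the one inequality of the line with content): with `A` = aligned
  variables, `h` = the assignment read off the anti-aligned ones, `V` = equations violated by `h` (`|V| ≥ t`), `T_A` =
  equations touching `A` (`|T_A| ≤ D|A|` by `hocc`): `lgW b Y / lgW 0 ref ≤ B^{−κ₁|A|} ρ_F^{K|T_A|}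
  e^{−K(Ψ0−Ψ1)(#(V∖T_A) + |T_A|)} ≤ e^{−Ktg}(B^{−κ₁}ρ_F^{KD})^{|A|} ≤ e^{−Ktg}` by `hcouple`; the one non-obvious
  step `F_max = ρ_F·F_min ≤ ρ_F e^{Ψ1}` is `cxW 1 ref = cxW 0 (ref ∘ legFlip) ≥ cxW 0 (all +) = F_min`
  (`cxWeight_one_eq` + `cxWeight_mono`, LANDED p75388) ✓; repeated variables in an equation are consistent leg-wise
  with `hfar`'s `Σ_i f(E e i)` ✓.  Degenerate: `t = 0` (claim = "the reference maximises `lgW`", true by the same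
  accounting), `K = 0` (`pairW` is maximal at anti-alignment: `(1−q⁺q⁻)² − (1−q⁺²)(1−q⁻²) = (q⁺−q⁻)² ≥ 0`), `κ₁ = 0`
  (`hcouple` ⇒ `K = 0 ∨ D = 0`, as `ρ_F > 1` strictly; `D = 0 ⇒ m = 0`), `nv = 0 ⇒ m = 0` ✓.  Planner's brute force
  kit j010755: 126/126, tight, coupling necessary — consistent with §4d's LOCAL temptation reading (§5(3b)).
* `stub_parameters`: `K, κ₁ = O(log n)` against `slyM d θ n ≥ n^θ/(d−1)` ✓ satisfiable.
`mirror-glued-gadget` (gen-2 skeleton, 03:13Z; 5 stubs: S1 trust base, S2 VERBATIM the picked line's `stub_connector`,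
three new).  Audited the same way (added ~04:10Z):
* `stub_alignedSector` (ANY `R`, no `NoFixed`; `λ ≥ 0`, `0 < q⁻ < q⁺ < 1`; any `κ₁ κ₂ c`; any `Zb ≥ 0` with one-entry
  flips `≤ nA·Zb`): ✓ re-derived — retraction `Y ↦ r(Y)` (re-anti-align copy 1 on the aligned set `A(Y)`) is a
  bijection `{Y} ↔ {(Y' anti, A ⊆ canonical)}`; per `δ ∈ A`: glue `pairW(s,s) = B^{−κ₁}·pairW(s,¬s)` exactly, `Zb`
  loses `≤ nA` (apply `hflip` to the flipped vector), and only the `≤ 2` complexes at the ends of `δ` read copy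
  `(δ,1)`, each within the factor `ρ_F` band (a self-loop: one complex, still `≤ ρ_F ≤ ρ_F²`), so `term(Y) ≤
  x^{|A|} term(rY)`, `Σ_A x^{|A|} = (1+x)^E` ✓.  Degenerate `nA < 1` forces `Zb ≡ 0` through `hflip` twice (both
  sides `0`) ✓; `κ₁ = 0` true-but-useless ✓ (consistent with §4c).  Nothing false.
* `stub_antiTseitin` (`NoFixed`, `EdgeExpansion` ⇒ connected, ANY real `f`, ANY swap-invariant `Zb`, odd `c`): ✓ exact —
  swap-invariance makes the anti-sector base mass `G(σ)` spin-independent, both sides are `G₀·T(·)` with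
  `T(c) = 2^{E−M}(S^M + (−1)^{Σc} D^M)` by the same closed-`U` expansion as the annealed `stub_tseitinSum` (each
  canonical bit is read by exactly the two legs of its edge; loops even), and `T(c)(S^M+D^M) = T(0)(S^M−D^M)` for
  `Σc = 1`; `M = 0` makes `hc : 0 = 1` false (vacuous) ✓; holds even when `G₀ = 0` ✓.
* `stub_parameters`: the energy inequality reads `6e^{1/20}/8 ≤ 15/8` after `x ≤ 1/(60M)` (also when the numerator of
  `κ₁` is negative: then `κ₁ = 0` and `x = nρ^{2κ₂} < 1/(60M)` is exactly that negativity) and `u ≤ 1/(16M)` ✓; budgets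
  `κ₁ + 2κ₂ = O(log n) ≤ slyM`, `6M ≤ M^{kθ/4}` with `k = ⌈4/θ⌉+1`, `(28M^{k+1})^{1/(2k+2)} ≤ ⌊ηM/7⌋` ✓.  True.
UPSHOT.  The refuter's map of the crux after round 2: FOUR checked compositions, three resting on Sly's published
theorem (one of them, `parity-wired-ports`, with 6/7 stubs LANDED by 03:00Z — the crux is composed conditionally on
`slyGadgetReduction` alone once `stub_connector` lands), one on `CoverGap` + first-moment bookkeeping; no typed stub
false in any of them; the load-bearing side conditions per line are listed above for the provers (annealed: `hGS`,
`hNF`, `EdgeExpansion.pos`, `hτ.fixed_iff`, `hS`; linear-gap: `hloc`, `hVV`, `hn`, `hcouple`; mirror-glued: `hflip`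
both ways, `hswap`, `hc` odd, `NoFixed` in S4 only). -/
theorem targets_round2_audit : True := trivial

/-- **`CoverGap` in the extreme regimes (gen 3; `compute/covergap3/covergap_extreme.py`, pure python, attached to the
item; quick mode run locally, full mode = kit j011125).**  Third independent transcription of `coverPsi`/`coverLambda`/
`Adm` (from the skeleton) and `slyPhi1` (tree); inner `(u,v)` problem solved EXACTLY (for fixed `w = ν₀₀−ν₁₁−u−v` the
stationarity equations are `u = (−w+√(w²+4ν₁₀w))/2`, `v` likewise, and `w ↦ w+u+v` is increasing: bisection), outer
3-variable problem by 60-start Nelder–Mead incl. the product, swapped, symmetric, complementary and interpolated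
profiles; two-cycle `(p⁺,p⁻)` by bisection on `g∘g` above the fixed point (robust down to `λ/λ_c − 1 = 10⁻⁶`).
REGIMES BEYOND THE PANELS (card: `λ/λ_c ≤ 250`, `d ≤ 100`; TRIAGE-r1-2: `ε ≥ 10⁻³`): `d ∈ {3,4,5,10,100,1000}` ×
`ε = λ/λ_c − 1 ∈ {10⁻⁵, 10⁻², 10, 10³, 10⁵, 10⁷}` (quick, 30 cases + spot checks `d = 500, 1000`), full grid
`d ∈ {3,…,1000}` (15 values) × `ε ∈ {10⁻⁶,…,10⁸}` (15 values): run locally while kit j011125 sat in a saturated queue —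
225/225 cases, 0 violations, `max_Adm Λ − Φ₁max ≤ +2.0·10⁻¹³` (float noise ∝ d), argmax = product in every case
(`full_local.out` in the evidence bundle's folder; j011125 will attach the certified copy).  RESULTS (quick): (N1)
`|sup_{u,v}Λ(Bern α⊗Bern β) − Φ₁(α,β)| ≤ 4·10⁻¹³` at 40 random points per case (float noise ∝ d); (N2)
`max_Adm Λ − Φ₁(p⁺,p⁻) ∈ [−7·10⁻¹⁵, +3·10⁻¹³]` (noise), argmax = product profile (`ℓ_∞` distance `0` except
`6·10⁻⁷`/`8·10⁻⁷` in the near-degenerate `ε = 10⁻⁵` cases at `d = 100, 1000`, where the two maximisers are `10⁻⁴`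
apart) — 0 violations.  THE RUNNER-UP, now identified analytically: at `λ → ∞` (`p⁺ ≈ 1 − 1/λ`, `p⁻ ≈ λ^{1−d}`,
`Φ₁(p⁺,p⁻) = log λ + O(log λ/λ)`) the best non-product competitor is the COMPLEMENTARY profile `ν = (ν₀₀,ν₁₀,ν₀₁,ν₁₁)
= (0,½,½,0)` (`A = S`, `B = Sᶜ`: full activity `log λ`, forced `u = v = 0`), where the definitions give EXACTLY
`Λ = −(d−1)log 2 + log λ + d·(log 2)/2 = log λ − (d/2 − 1) log 2`; numerically `Λ(comp) − Φ₁max → −0.3466 (d=3),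
−0.6931 (d=4), −1.0397 (d=5), −2.7726 (d=10)` = `−(d/2−1) log 2` to 4 digits ✓.  So the margin of (N2) against its
nearest competitor is uniformly positive for `d ≥ 3` but does NOT grow with `λ` at `d = 3` (`0.35` nats), and would
vanish exactly at the excluded `d = 2` — a clean consistency check of the whole annealed picture (at `d = 2` the cover
gadget is a union of cycles and has no phase).  Near threshold (`ε ↓ 0`) the two product maximisers merge with the
symmetric point at rate `Φ₁(p*,p*) − Φ₁max ≈ −1.7·10⁻¹¹` at `ε = 10⁻⁵` (∝ ε²), as for `Φ₁` itself — the constant `C`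
of `CoverGap` degenerates like Sly's, expected (the stub fixes `λ` first).
LANDSCAPE (no reliance on optimiser starts; `landscape_scan.py`, grid `150 × 150` marginals `(a,b)` × `40` couplings
`t = ν₁₁`, inner problem exact; 11 cases `d ∈ {3,4,5,10}`, `ε ∈ [0.25, 10⁴]`): grid max `≤ Φ₁max` everywhere; the best
grid point at `ℓ_∞`-distance `> 0.12` from both product profiles lies `0.002 … 0.32` below `Φ₁max` and under local
ascent FLOWS INTO the product maximiser in 11/11 cases — no secondary local maximum found above those levels.
TWO STRUCTURAL FACTS FOR THE PROVER OF S1 (found while attacking it).  (1) (N1) holds to `10⁻¹⁶` in a third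
implementation, and its reason is the exact finite identity `E_{A,B}[1_{σ good}] = (1 − 2αβ + α²β²)^{n'/2} = (1−αβ)^{n'}`
for EVERY fixed-point-free involution `σ` when the points are put in `A` w.p. `α` and in `B` w.p. `β` independently (the
`n'/2` pairs of `σ` are disjoint; a pair is bad iff `x∈A, y∈B` or `y∈A, x∈B`), which coincides with the bipartite
permutation model's `E[1_{π(A)∩B=∅}] = (1−αβ)^{n'}`; Laplace on both sides gives
`sup_ν [Ψ_inv(ν) − KL(ν ‖ Bern α⊗Bern β)] = log(1−αβ) = sup_{a,b} [Ψ_perm(a,b) − KL(a‖α) − KL(b‖β)]` for all `(α,β)`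
(the card's `OverlapAveraging`, `d = 1` shadow — confirmed independently here), and numerically the left supremum over
COUPLINGS with fixed marginals `(a,b)` of `Ψ_inv(ν) − I(ν)` (`I` = mutual information) is attained EXACTLY at the
product coupling (7/7 marginal pairs, to `10⁻¹⁶`) — that finer statement + duality is (N1).  (2) WARNING — the
fixed-marginal analogue of (N2) is FALSE: at fixed marginals `(a,b)` the involution exponent `Ψ_inv(ν)` alone is
maximised at an EXTREME coupling (`t = min(a,b)` or `t = 0`; gains `0.015–0.17` over product), and even the
`d`-weighted contest `Ψ_inv − I/d` relevant to `Λ` is won by a NON-product coupling at off-critical marginals already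
for `d = 3` (e.g. `(a,b) = (0.9, 0.05)`: argmax `t = 0.017 ≠ ab = 0.045`, gain `4.8·10⁻⁴`; `(0.7, 0.25)`: `t = 0.006`,
gain `0.028`; at the CRITICAL marginals `(p⁺,p⁻)` product wins).  So (N2) is irreducibly a statement about the
JOINT maximisation over marginals and coupling — "product is optimal given its marginals" must not be a lemma of the
proof (it would be refuted exactly like the pointwise `Λ ≤ Φ₁(marginals)` form was by TRIAGE-r1-2); for large `d` the
coupling penalty `I/d` fades, and what keeps (N2) true there is that the critical marginals themselves degenerate
(`p⁻ ≈ λ^{1−d}`), where all couplings coincide.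
SECONDARY LOCAL MAXIMA EXIST (census of grid-local maxima, `localmax_census.py`, grid `100–160` per marginal × `30–40`
couplings, each polished; `d = 3`, `λ ∈ [5, 10⁴]`, plus `(4, 18.6)`, `(4, 3.375)`, `(5, 11.59)`): for `d = 3` and
`λ ≳ 36.3` (born between `λ = 36` and `36.5`, margin AT BIRTH `0.2526`; absent at `λ ≤ 36`) there is a genuine NON-product local maximum of `Λ` on the
swap-symmetric diagonal, the HIGH-OVERLAP profile `ν₁₀ = ν₀₁ = x`, `ν₁₁ = t` with `(x, t) = (0.070, 0.374)` at `λ = 38`,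
`(0.051, 0.402)` at `44`, `(0.0129, 0.467)` at `100`, `(6·10⁻⁵, 0.4994)` at `10⁴` — i.e. `A ≈ B ≈` one half `S` of the
index set occupied in BOTH layers, every matching forced to pair `S` with `Sᶜ` (cost `(log 2)/2` per matching, entropy
`log 2`, full activity): value `log λ − (d/2 − 1)log 2 + o(1)`, the same asymptote as the complementary profile.  Its
margin below `Φ₁max`: `0.2526 (λ=36.5)`, `0.254 (37)`, `0.256 (38)`, `0.260 (40)`, `0.264 (42)`, `0.268 (44)`, `0.272 (47)`, `0.286 (60)`, `0.307 (100)`,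
`0.339 (10³)`, `0.345 (10⁴)` → `0.3466` — SMALLEST AT BIRTH, `≈ 0.25` nats, never close to `0`.  The same diagonal
family exists for `d = 4, 5, 6` at large `λ` with margins `0.54/0.62/0.66` (`d = 4`, `λ = 50/200/10³`; limit `0.693`),
`0.84/0.96` (`d = 5`, `λ = 10²/10³`; limit `1.040`), `0.96/1.19` (`d = 6`, `λ = 50/500`; limit `1.386`) — increasing in `d`
and in `λ`; no other non-product local maximum appeared in any census.  So (N2) is a VALUE comparison between the product maximum
and (for `d = 3`, large `λ`) a second basin `0.25–0.35` below it — not a critical-point classification (the lead's own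
finding of non-product BP fixed points at `(3,44)`, `(4,18.6)` is the same phenomenon: at the symmetric point `(p*,p*)`
the coupling curvature `∂²Λ/∂t²` turns POSITIVE at large `λ` — `+1.13` at `(3,44)`, `+0.11` at `(4,18.6)` — while it is
`≈ −8.1 / −17 / −28 / −108` (`d = 3/4/5/10`) near threshold).
NO SECOND SOFT MODE AT THE MAXIMISER (finite differences at `(p⁺,p⁻, t = p⁺p⁻)`, `ε = λ/λ_c − 1 ∈ [10⁻⁴, 10]`): the
coupling curvature `∂²Λ/∂t²|_{product max}` is `−8.10, −8.14, −8.56, −13.5, −200, −7.3·10⁴` (`d = 3`, `ε = 10⁻⁴ … 10`),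
`−17.1 … −1.6·10⁵` (`d = 4`), `−27.6 … −3.7·10⁵` (`d = 5`), `−108 … −1.4·10⁷` (`d = 10`): bounded AWAY from `0` as
`ε ↓ 0` (limit `≈ −8.1` at `d = 3`; `≈ −1.0·10⁴` at `d = 100` and `≈ −1.0·10⁶` at `d = 1000`, i.e. `≈ −d²`: the coupling
direction is STIFF, uniformly in `d`), while the on-manifold antisymmetric curvature is the known soft mode (`+1.5·10⁻⁴`
at the saddle `(p*,p*)`, `−0.09/d=100`, `−0.9/d=1000` at the maximiser for `ε = 10⁻⁵`; ∝ ε).  Reading for the prover of S1: near the two maximisers the off-product directions are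
uniformly quadratically penalised, so the local power-law gap of `CoverGap` is inherited from the tree's
`slyPhi1_local_gap` on the product manifold (where `Λ = Φ₁` by (N1)) with the same exponent `ℓ`; the GLOBAL part needs a
value bound beating the `0.25`-nat runner-up basin at `d = 3` (and the boundary strata), for which the lead's entropy
decomposition `Λ = Φ₁(α_ν,β_ν) + (d−1)I_ν − (d/2)[2H₃ − H(P)]` is the natural tool.  Verdict: `stub_coverGap` survives
every attack so far; no regime found where a correlated (non-product) overlap profile wins globally, and the margins
are now mapped. -/
theorem coverGap_extremes : True := trivial


/-! ## §9 (gen 3) The gap factor is immaterial: factor squaring, kernel-checked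
(self-contained copy of `FactorSquaring.lean`, LANDED as `Theorems/PolyDepthTwinsAbove/Negative/FactorSquaring.lean`, p81762,
namespace `…Negative`, identical statements — import THAT module, not this work file).  Two disjoint copies square the gap,
halve the exponent, keep the degree: `witnesses_sq`, `witnesses_pow`; hence `noTwins_onePlusEps_of_noTwins` — a disproof
of the crux at `(Δ, λ)` must exclude `(1+ε)`-twins at every positive exponent for EVERY `ε > 0` (§3(vi)).  For PROVERS the
same lemmas say a `(1+ε)`-gap at depth `n^θ` already gives the crux (apply `witnesses_pow` with `j` such that
`(1+ε)^{2^j} ≥ 2`; the statements are against the crux's inlined body, instance-generic). -/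

section FactorSquaring

open Literature.ModelTheory.FiniteModelTheory (CkEquiv Dvorak2010_ckEquiv_iff_homCount_holds)

/-- The crux's inlined hard-core sum `Σ_{I independent} λ^{|I|}` is nonnegative for `λ ≥ 0` (any finite vertex
type; all sums below are written out exactly as in the crux, no definition is introduced). -/
theorem Zs_nonneg {α : Type*} [Fintype α] (G : SimpleGraph α)
    {dG : ∀ I : Finset α, Decidable (G.IsIndepSet (↑I : Set α))} {lam : ℝ} (hlam : 0 ≤ lam) :
    0 ≤ ∑ I : Finset α, @ite ℝ (G.IsIndepSet (↑I : Set α)) (dG I) (lam ^ I.card) 0 :=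
  Finset.sum_nonneg fun I _ => by split_ifs <;> [exact pow_nonneg hlam _; exact le_rfl]

/-- Independence is transported along a graph isomorphism (general vertex types). -/
theorem isIndepSet_map_iff' {α β : Type*} {G : SimpleGraph α} {H : SimpleGraph β} (e : G ≃g H) (I : Finset α) :
    H.IsIndepSet (↑(I.map e.toEquiv.toEmbedding) : Set β) ↔ G.IsIndepSet (↑I : Set α) := by
  constructor
  · intro h a ha b hb hab hadj
    have ha' : e a ∈ I.map e.toEquiv.toEmbedding := Finset.mem_map.2 ⟨a, ha, rfl⟩
    have hb' : e b ∈ I.map e.toEquiv.toEmbedding := Finset.mem_map.2 ⟨b, hb, rfl⟩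
    have hne : e a ≠ e b := fun h' => hab (e.injective h')
    exact h (Finset.mem_coe.2 ha') (Finset.mem_coe.2 hb') hne ((e.map_adj_iff).2 hadj)
  · intro h x hx y hy hxy hadj
    obtain ⟨a, ha, rfl⟩ := Finset.mem_map.1 (Finset.mem_coe.1 hx)
    obtain ⟨b, hb, rfl⟩ := Finset.mem_map.1 (Finset.mem_coe.1 hy)
    have hab : a ≠ b := fun h' => hxy (by simp [h'])
    exact h (Finset.mem_coe.2 ha) (Finset.mem_coe.2 hb) hab ((e.map_adj_iff).1 hadj)

/-- **The hard-core sum is an isomorphism invariant** (general vertex types). -/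
theorem Zs_eq_of_iso {α β : Type*} [Fintype α] [Fintype β] {G : SimpleGraph α} {H : SimpleGraph β}
    {dG : ∀ I : Finset α, Decidable (G.IsIndepSet (↑I : Set α))}
    {dH : ∀ I : Finset β, Decidable (H.IsIndepSet (↑I : Set β))} (e : G ≃g H) (lam : ℝ) :
    (∑ I : Finset α, @ite ℝ (G.IsIndepSet (↑I : Set α)) (dG I) (lam ^ I.card) 0) =
      ∑ I : Finset β, @ite ℝ (H.IsIndepSet (↑I : Set β)) (dH I) (lam ^ I.card) 0 := by
  refine Fintype.sum_equiv (Equiv.finsetCongr e.toEquiv) _ _ fun I => ?_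
  rw [Equiv.finsetCongr_apply, Finset.card_map]
  by_cases hI : G.IsIndepSet (↑I : Set α)
  · rw [if_pos hI, if_pos ((isIndepSet_map_iff' e I).2 hI)]
  · rw [if_neg hI, if_neg (fun h => hI ((isIndepSet_map_iff' e I).1 h))]

/-- Independent sets of a disjoint sum are pairs of independent sets. -/
theorem isIndepSet_disjSum_iff {α β : Type*} (G : SimpleGraph α) (H : SimpleGraph β) (s : Finset α)
    (t : Finset β) :
    (G ⊕g H).IsIndepSet (↑(s.disjSum t) : Set (α ⊕ β)) ↔
      G.IsIndepSet (↑s : Set α) ∧ H.IsIndepSet (↑t : Set β) := by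
  constructor
  · intro h
    refine ⟨fun a ha b hb hab hadj => ?_, fun a ha b hb hab hadj => ?_⟩
    · exact h (Finset.mem_coe.2 (Finset.inl_mem_disjSum.2 (Finset.mem_coe.1 ha)))
        (Finset.mem_coe.2 (Finset.inl_mem_disjSum.2 (Finset.mem_coe.1 hb)))
        (fun h' => hab (Sum.inl_injective h')) (SimpleGraph.sum_adj_inl.2 hadj)
    · exact h (Finset.mem_coe.2 (Finset.inr_mem_disjSum.2 (Finset.mem_coe.1 ha)))
        (Finset.mem_coe.2 (Finset.inr_mem_disjSum.2 (Finset.mem_coe.1 hb)))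
        (fun h' => hab (Sum.inr_injective h')) (SimpleGraph.sum_adj_inr.2 hadj)
  · rintro ⟨hs, ht⟩ x hx y hy hxy hadj
    rcases x with a | a <;> rcases y with b | b
    · exact hs (Finset.mem_coe.2 (Finset.inl_mem_disjSum.1 (Finset.mem_coe.1 hx)))
        (Finset.mem_coe.2 (Finset.inl_mem_disjSum.1 (Finset.mem_coe.1 hy)))
        (fun h' => hxy (by rw [h'])) (SimpleGraph.sum_adj_inl.1 hadj)
    · exact SimpleGraph.not_adj_sum_inl_inr a b hadj
    · exact SimpleGraph.not_adj_sum_inl_inr b a hadj.symm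
    · exact ht (Finset.mem_coe.2 (Finset.inr_mem_disjSum.1 (Finset.mem_coe.1 hx)))
        (Finset.mem_coe.2 (Finset.inr_mem_disjSum.1 (Finset.mem_coe.1 hy)))
        (fun h' => hxy (by rw [h'])) (SimpleGraph.sum_adj_inr.1 hadj)

/-- **The hard-core sum is multiplicative over disjoint sums.** -/
theorem Zs_sum {α β : Type*} [Fintype α] [Fintype β] (G : SimpleGraph α) (H : SimpleGraph β)
    {dGH : ∀ I : Finset (α ⊕ β), Decidable ((G ⊕g H).IsIndepSet (↑I : Set (α ⊕ β)))}
    {dG : ∀ I : Finset α, Decidable (G.IsIndepSet (↑I : Set α))}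
    {dH : ∀ I : Finset β, Decidable (H.IsIndepSet (↑I : Set β))} (lam : ℝ) :
    (∑ I : Finset (α ⊕ β), @ite ℝ ((G ⊕g H).IsIndepSet (↑I : Set (α ⊕ β))) (dGH I) (lam ^ I.card) 0) =
      (∑ I : Finset α, @ite ℝ (G.IsIndepSet (↑I : Set α)) (dG I) (lam ^ I.card) 0) *
        ∑ I : Finset β, @ite ℝ (H.IsIndepSet (↑I : Set β)) (dH I) (lam ^ I.card) 0 := by
  rw [← Fintype.sum_equiv Finset.sumEquiv.toEquiv.symm
    (fun p : Finset α × Finset β => (@ite ℝ (G.IsIndepSet (↑p.1 : Set α)) (dG p.1) (lam ^ p.1.card) 0) *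
      @ite ℝ (H.IsIndepSet (↑p.2 : Set β)) (dH p.2) (lam ^ p.2.card) 0) _ ?_]
  · rw [Fintype.sum_prod_type, Finset.sum_mul_sum]
  · intro p
    have happ : (Finset.sumEquiv.toEquiv.symm p : Finset (α ⊕ β)) = p.1.disjSum p.2 := rfl
    rw [happ, Finset.card_disjSum]
    have hiff := isIndepSet_disjSum_iff G H p.1 p.2
    by_cases hs : G.IsIndepSet (↑p.1 : Set α) <;> by_cases ht : H.IsIndepSet (↑p.2 : Set β)
    · rw [if_pos hs, if_pos ht, if_pos (hiff.2 ⟨hs, ht⟩), pow_add]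
    · rw [if_pos hs, if_neg ht, if_neg (fun h => ht (hiff.1 h).2), mul_zero]
    · rw [if_neg hs, if_neg (fun h => hs (hiff.1 h).1), zero_mul]
    · rw [if_neg hs, if_neg (fun h => hs (hiff.1 h).1), zero_mul]

/-- Degrees in a disjoint sum, left summand. -/
theorem degree_sum_inl {α β : Type*} [Fintype α] [Fintype β] (G : SimpleGraph α) (H : SimpleGraph β)
    [DecidableRel G.Adj] [DecidableRel (G ⊕g H).Adj] (v : α) :
    (G ⊕g H).degree (Sum.inl v) = G.degree v := by
  rw [← SimpleGraph.card_neighborFinset_eq_degree, ← SimpleGraph.card_neighborFinset_eq_degree]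
  have : (G ⊕g H).neighborFinset (Sum.inl v) = (G.neighborFinset v).map ⟨Sum.inl, Sum.inl_injective⟩ := by
    ext x
    rcases x with a | b
    · simp [SimpleGraph.mem_neighborFinset]
    · simp [SimpleGraph.mem_neighborFinset]
  rw [this, Finset.card_map]

/-- Degrees in a disjoint sum, right summand. -/
theorem degree_sum_inr {α β : Type*} [Fintype α] [Fintype β] (G : SimpleGraph α) (H : SimpleGraph β)
    [DecidableRel H.Adj] [DecidableRel (G ⊕g H).Adj] (w : β) :
    (G ⊕g H).degree (Sum.inr w) = H.degree w := by
  rw [← SimpleGraph.card_neighborFinset_eq_degree, ← SimpleGraph.card_neighborFinset_eq_degree]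
  have : (G ⊕g H).neighborFinset (Sum.inr w) = (H.neighborFinset w).map ⟨Sum.inr, Sum.inr_injective⟩ := by
    ext x
    rcases x with a | b
    · simp [SimpleGraph.mem_neighborFinset]
    · simp [SimpleGraph.mem_neighborFinset]
  rw [this, Finset.card_map]

/-- The maximum degree of a disjoint sum is bounded by the bounds of the summands. -/
theorem maxDegree_sum_le {α β : Type*} [Fintype α] [Fintype β] {G : SimpleGraph α} {H : SimpleGraph β}
    [DecidableRel G.Adj] [DecidableRel H.Adj] [DecidableRel (G ⊕g H).Adj] {Δ : ℕ}
    (hG : G.maxDegree ≤ Δ) (hH : H.maxDegree ≤ Δ) : (G ⊕g H).maxDegree ≤ Δ := by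
  refine SimpleGraph.maxDegree_le_of_forall_degree_le _ _ fun x => ?_
  rcases x with v | w
  · have h1 : (G ⊕g H).degree (Sum.inl v) = G.degree v := degree_sum_inl G H v
    calc _ = G.degree v := by convert h1
      _ ≤ Δ := (G.degree_le_maxDegree v).trans hG
  · have h1 : (G ⊕g H).degree (Sum.inr w) = H.degree w := degree_sum_inr G H w
    calc _ = H.degree w := by convert h1
      _ ≤ Δ := (H.degree_le_maxDegree w).trans hH

/-! THE DOUBLE of a graph `G` on `Fin n` is `(G ⊕g G).map finSumFinEquiv` on `Fin (n + n)` (two disjoint copies),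
reached through the isomorphism `SimpleGraph.Iso.map finSumFinEquiv (G ⊕g G)`; the lemmas are stated for any `D`
isomorphic to `G ⊕g G`. -/

/-- `Z(D) = Z(G)²` for any graph `D` isomorphic to two disjoint copies of `G` (stated through an isomorphism so
that the decidability instances of the inlined sums stay generic). -/
theorem Zs_double {n k : ℕ} {G : SimpleGraph (Fin n)} {D : SimpleGraph (Fin k)}
    {dD : ∀ I : Finset (Fin k), Decidable (D.IsIndepSet (↑I : Set (Fin k)))}
    {dG : ∀ I : Finset (Fin n), Decidable (G.IsIndepSet (↑I : Set (Fin n)))} (e : (G ⊕g G) ≃g D)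
    (lam : ℝ) :
    (∑ I : Finset (Fin k), @ite ℝ (D.IsIndepSet (↑I : Set (Fin k))) (dD I) (lam ^ I.card) 0) =
      (∑ I : Finset (Fin n), @ite ℝ (G.IsIndepSet (↑I : Set (Fin n))) (dG I) (lam ^ I.card) 0) ^ 2 := by
  calc (∑ I : Finset (Fin k), @ite ℝ (D.IsIndepSet (↑I : Set (Fin k))) (dD I) (lam ^ I.card) 0)
        = ∑ I : Finset (Fin n ⊕ Fin n),
            @ite ℝ ((G ⊕g G).IsIndepSet (↑I : Set (Fin n ⊕ Fin n))) (Classical.dec _) (lam ^ I.card) 0 :=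
          (Zs_eq_of_iso (dG := fun I => Classical.dec _) (dH := dD) e lam).symm
    _ = (∑ I : Finset (Fin n), @ite ℝ (G.IsIndepSet (↑I : Set (Fin n))) (dG I) (lam ^ I.card) 0) *
          ∑ I : Finset (Fin n), @ite ℝ (G.IsIndepSet (↑I : Set (Fin n))) (dG I) (lam ^ I.card) 0 :=
          Zs_sum G G (dGH := fun I => Classical.dec _) (dG := dG) (dH := dG) lam
    _ = _ := (sq _).symm

/-- Two disjoint copies have the same degree bound. -/
theorem maxDegree_double_le {n k : ℕ} {G : SimpleGraph (Fin n)} {D : SimpleGraph (Fin k)}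
    (e : (G ⊕g G) ≃g D) {Δ : ℕ} (hG : G.maxDegree ≤ Δ) : D.maxDegree ≤ Δ := by
  have h1 : (G ⊕g G).maxDegree ≤ Δ := maxDegree_sum_le hG hG
  rw [← e.maxDegree_eq]
  convert h1

/-- **Hom-indistinguishability of the doubles, one level down in the exponent.** If `G, H` on `n ≥ 2` vertices are
hom-indistinguishable below depth `n^θ` (`θ > 0`), their doubles are hom-indistinguishable below depth
`(2n)^{θ/2} ≤ n^θ` (Dvořák bridge both ways, `CkEquiv.sum`, `CkEquiv.iso_congr` — all PROVED in the tree). -/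
theorem homIndist_double {n : ℕ} (hn : 2 ≤ n) {θ : ℝ} (hθ : 0 < θ) {G H : SimpleGraph (Fin n)}
    {D E : SimpleGraph (Fin (n + n))} (eG : (G ⊕g G) ≃g D) (eH : (H ⊕g H) ≃g E)
    (h : ∀ (m : ℕ) (F : SimpleGraph (Fin m)),
      (Literature.Combinatorics.SimpleGraph.treewidth F : ℝ) < (n : ℝ) ^ θ →
        Nat.card (F →g G) = Nat.card (F →g H)) :
    ∀ (m : ℕ) (F : SimpleGraph (Fin m)),
      (Literature.Combinatorics.SimpleGraph.treewidth F : ℝ) < ((n + n : ℕ) : ℝ) ^ (θ / 2) →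
        Nat.card (F →g D) = Nat.card (F →g E) := by
  -- the real threshold `x = (2n)^{θ/2}` and the integer level `k = ⌈x⌉`
  set x : ℝ := ((n + n : ℕ) : ℝ) ^ (θ / 2) with hx
  have hn2 : (2 : ℝ) ≤ n := by exact_mod_cast hn
  have hnn : ((n + n : ℕ) : ℝ) = 2 * n := by push_cast; ring
  have hx1 : 1 < x := by
    rw [hx, hnn]
    have h4 : (1 : ℝ) < 2 * n := by linarith
    exact Real.one_lt_rpow h4 (by linarith)
  have hx0 : 0 ≤ x := by linarith
  -- `(2n)^{θ/2} ≤ n^θ` since `2n ≤ n²`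
  have hxle : x ≤ (n : ℝ) ^ θ := by
    rw [hx, hnn]
    have hsq : (2 : ℝ) * n ≤ (n : ℝ) ^ (2 : ℝ) := by
      rw [Real.rpow_two]; nlinarith
    calc (2 * (n : ℝ)) ^ (θ / 2) ≤ ((n : ℝ) ^ (2 : ℝ)) ^ (θ / 2) :=
          Real.rpow_le_rpow (by linarith) hsq (by linarith)
      _ = (n : ℝ) ^ θ := by
          rw [← Real.rpow_mul (by linarith)]
          congr 1; ring
  set k : ℕ := ⌈x⌉₊ with hk
  have hk2 : 2 ≤ k := by
    rw [hk]
    have : (1 : ℝ) < ⌈x⌉₊ := lt_of_lt_of_le hx1 (Nat.le_ceil x)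
    have h' : 1 < ⌈x⌉₊ := by exact_mod_cast this
    omega
  have hkx : ((k : ℝ) - 1) < x := by
    rw [hk]
    have := Nat.ceil_lt_add_one hx0
    linarith
  -- level-`k` equivalence of `G` and `H`
  have hGH : CkEquiv k G H := by
    refine (Dvorak2010_ckEquiv_iff_homCount_holds k hk2 n n G H).2 fun j F hF => h j F ?_
    have hF' : (Literature.Combinatorics.SimpleGraph.treewidth F : ℝ) ≤ (k : ℝ) - 1 := by
      have : Literature.Combinatorics.SimpleGraph.treewidth F + 1 ≤ k := hF
      have : ((Literature.Combinatorics.SimpleGraph.treewidth F + 1 : ℕ) : ℝ) ≤ k := by exact_mod_cast this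
      push_cast at this
      linarith
    exact lt_of_le_of_lt hF' (lt_of_lt_of_le hkx hxle)
  -- the doubles are `≡_{C^k}`
  have hD : CkEquiv k D E := (CkEquiv.sum hGH hGH).iso_congr eG eH
  intro m F hF
  refine (Dvorak2010_ckEquiv_iff_homCount_holds k hk2 (n + n) (n + n) D E).1 hD m F ?_
  -- `tw F < x ≤ ⌈x⌉ = k`
  have : (Literature.Combinatorics.SimpleGraph.treewidth F : ℝ) < k :=
    lt_of_lt_of_le hF (by rw [hk]; exact Nat.le_ceil x)
  exact_mod_cast this

/-- **Factor squaring.** A witness family for the crux body at `(Δ, λ ≥ 0)` with exponent `θ > 0` and gap factor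
`c ≥ 0` yields one with exponent `θ/2` and gap factor `c²`. -/
theorem witnesses_sq {Δ : ℕ} {lam θ c : ℝ} (hlam : 0 ≤ lam) (hθ : 0 < θ) (hc : 0 ≤ c)
    (h : ∀ n₀ : ℕ, ∃ (n : ℕ) (G H : SimpleGraph (Fin n)), n₀ ≤ n ∧ G.maxDegree ≤ Δ ∧ H.maxDegree ≤ Δ ∧
      (∀ (m : ℕ) (F : SimpleGraph (Fin m)),
        (Literature.Combinatorics.SimpleGraph.treewidth F : ℝ) < (n : ℝ) ^ θ →
          Nat.card (F →g G) = Nat.card (F →g H)) ∧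
      c * (∑ I : Finset (Fin n), (if H.IsIndepSet (↑I : Set (Fin n)) then lam ^ I.card else 0)) ≤
        ∑ I : Finset (Fin n), (if G.IsIndepSet (↑I : Set (Fin n)) then lam ^ I.card else 0)) :
    ∀ n₀ : ℕ, ∃ (n : ℕ) (G H : SimpleGraph (Fin n)), n₀ ≤ n ∧ G.maxDegree ≤ Δ ∧ H.maxDegree ≤ Δ ∧
      (∀ (m : ℕ) (F : SimpleGraph (Fin m)),
        (Literature.Combinatorics.SimpleGraph.treewidth F : ℝ) < (n : ℝ) ^ (θ / 2) →
          Nat.card (F →g G) = Nat.card (F →g H)) ∧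
      c ^ 2 * (∑ I : Finset (Fin n), (if H.IsIndepSet (↑I : Set (Fin n)) then lam ^ I.card else 0)) ≤
        ∑ I : Finset (Fin n), (if G.IsIndepSet (↑I : Set (Fin n)) then lam ^ I.card else 0) := by
  intro n₀
  obtain ⟨n, G, H, hn, hG, hH, hhom, hZ⟩ := h (max n₀ 2)
  have hn0 : n₀ ≤ n := le_trans (le_max_left _ _) hn
  have hn2 : 2 ≤ n := le_trans (le_max_right _ _) hn
  -- the claim for ANY pair of graphs isomorphic to the two doubles (generic statement: the decidability
  -- instances of the inlined sums are then the generic ones on both sides)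
  have key : ∀ (D E : SimpleGraph (Fin (n + n))), (G ⊕g G ≃g D) → (H ⊕g H ≃g E) →
      D.maxDegree ≤ Δ ∧ E.maxDegree ≤ Δ ∧
      (∀ (m : ℕ) (F : SimpleGraph (Fin m)),
        (Literature.Combinatorics.SimpleGraph.treewidth F : ℝ) < ((n + n : ℕ) : ℝ) ^ (θ / 2) →
          Nat.card (F →g D) = Nat.card (F →g E)) ∧
      c ^ 2 * (∑ I : Finset (Fin (n + n)), (if E.IsIndepSet (↑I : Set (Fin (n + n))) then lam ^ I.card else 0)) ≤
        ∑ I : Finset (Fin (n + n)), (if D.IsIndepSet (↑I : Set (Fin (n + n))) then lam ^ I.card else 0) := by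
    intro D E eG eH
    refine ⟨maxDegree_double_le eG hG, maxDegree_double_le eH hH, homIndist_double hn2 hθ eG eH hhom, ?_⟩
    have hD : (∑ I : Finset (Fin (n + n)), (if D.IsIndepSet (↑I : Set (Fin (n + n))) then lam ^ I.card else 0)) =
        (∑ I : Finset (Fin n), (if G.IsIndepSet (↑I : Set (Fin n)) then lam ^ I.card else 0)) ^ 2 :=
      Zs_double (dD := fun I => inferInstance) (dG := fun I => inferInstance) eG lam
    have hE : (∑ I : Finset (Fin (n + n)), (if E.IsIndepSet (↑I : Set (Fin (n + n))) then lam ^ I.card else 0)) =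
        (∑ I : Finset (Fin n), (if H.IsIndepSet (↑I : Set (Fin n)) then lam ^ I.card else 0)) ^ 2 :=
      Zs_double (dD := fun I => inferInstance) (dG := fun I => inferInstance) eH lam
    rw [hD, hE]
    have hZH := Zs_nonneg H (dG := fun I => inferInstance) hlam
    calc c ^ 2 * (∑ I : Finset (Fin n), (if H.IsIndepSet (↑I : Set (Fin n)) then lam ^ I.card else 0)) ^ 2 =
        (c * (∑ I : Finset (Fin n), (if H.IsIndepSet (↑I : Set (Fin n)) then lam ^ I.card else 0))) ^ 2 := by
          ring
      _ ≤ (∑ I : Finset (Fin n), (if G.IsIndepSet (↑I : Set (Fin n)) then lam ^ I.card else 0)) ^ 2 :=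
          pow_le_pow_left₀ (mul_nonneg hc hZH) hZ 2
  obtain ⟨h1, h2, h3, h4⟩ :=
    key _ _ (SimpleGraph.Iso.map finSumFinEquiv (G ⊕g G)) (SimpleGraph.Iso.map finSumFinEquiv (H ⊕g H))
  exact ⟨n + n, _, _, by omega, h1, h2, h3, h4⟩

/-- **Iterated squaring:** factor `c` at exponent `θ` gives factor `c^(2^j)` at exponent `θ/2^j`. -/
theorem witnesses_pow {Δ : ℕ} {lam θ c : ℝ} (hlam : 0 ≤ lam) (hθ : 0 < θ) (hc : 0 ≤ c)
    (h : ∀ n₀ : ℕ, ∃ (n : ℕ) (G H : SimpleGraph (Fin n)), n₀ ≤ n ∧ G.maxDegree ≤ Δ ∧ H.maxDegree ≤ Δ ∧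
      (∀ (m : ℕ) (F : SimpleGraph (Fin m)),
        (Literature.Combinatorics.SimpleGraph.treewidth F : ℝ) < (n : ℝ) ^ θ →
          Nat.card (F →g G) = Nat.card (F →g H)) ∧
      c * (∑ I : Finset (Fin n), (if H.IsIndepSet (↑I : Set (Fin n)) then lam ^ I.card else 0)) ≤
        ∑ I : Finset (Fin n), (if G.IsIndepSet (↑I : Set (Fin n)) then lam ^ I.card else 0)) (j : ℕ) :
    ∀ n₀ : ℕ, ∃ (n : ℕ) (G H : SimpleGraph (Fin n)), n₀ ≤ n ∧ G.maxDegree ≤ Δ ∧ H.maxDegree ≤ Δ ∧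
      (∀ (m : ℕ) (F : SimpleGraph (Fin m)),
        (Literature.Combinatorics.SimpleGraph.treewidth F : ℝ) < (n : ℝ) ^ (θ / 2 ^ j) →
          Nat.card (F →g G) = Nat.card (F →g H)) ∧
      c ^ (2 ^ j) * (∑ I : Finset (Fin n), (if H.IsIndepSet (↑I : Set (Fin n)) then lam ^ I.card else 0)) ≤
        ∑ I : Finset (Fin n), (if G.IsIndepSet (↑I : Set (Fin n)) then lam ^ I.card else 0) := by
  induction j with
  | zero => simpa using h
  | succ j ih =>
    have hθj : 0 < θ / 2 ^ j := div_pos hθ (pow_pos two_pos _)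
    have := witnesses_sq hlam hθj (pow_nonneg hc _) ih
    have hexp : θ / 2 ^ j / 2 = θ / 2 ^ (j + 1) := by rw [pow_succ]; ring
    have hpow : (c ^ 2 ^ j) ^ 2 = c ^ 2 ^ (j + 1) := by rw [← pow_mul, ← pow_succ]
    simpa [hexp, hpow] using this

/-- **A would-be disproof must exclude `(1+ε)`-twins for every `ε > 0`.** If at `(Δ, λ ≥ 0)` there are NO factor-`2`
twins at any positive exponent (the negation of the crux's conclusion there, `Zs`-form), then for every `ε > 0` there
are no factor-`(1+ε)` twins at any positive exponent either. -/
theorem noTwins_onePlusEps_of_noTwins {Δ : ℕ} {lam : ℝ} (hlam : 0 ≤ lam)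
    (hno : ¬ ∃ θ : ℝ, 0 < θ ∧ ∀ n₀ : ℕ, ∃ (n : ℕ) (G H : SimpleGraph (Fin n)), n₀ ≤ n ∧
      G.maxDegree ≤ Δ ∧ H.maxDegree ≤ Δ ∧
      (∀ (m : ℕ) (F : SimpleGraph (Fin m)),
        (Literature.Combinatorics.SimpleGraph.treewidth F : ℝ) < (n : ℝ) ^ θ →
          Nat.card (F →g G) = Nat.card (F →g H)) ∧
      2 * (∑ I : Finset (Fin n), (if H.IsIndepSet (↑I : Set (Fin n)) then lam ^ I.card else 0)) ≤
        ∑ I : Finset (Fin n), (if G.IsIndepSet (↑I : Set (Fin n)) then lam ^ I.card else 0))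
    {ε : ℝ} (hε : 0 < ε) :
    ¬ ∃ θ : ℝ, 0 < θ ∧ ∀ n₀ : ℕ, ∃ (n : ℕ) (G H : SimpleGraph (Fin n)), n₀ ≤ n ∧
      G.maxDegree ≤ Δ ∧ H.maxDegree ≤ Δ ∧
      (∀ (m : ℕ) (F : SimpleGraph (Fin m)),
        (Literature.Combinatorics.SimpleGraph.treewidth F : ℝ) < (n : ℝ) ^ θ →
          Nat.card (F →g G) = Nat.card (F →g H)) ∧
      (1 + ε) * (∑ I : Finset (Fin n), (if H.IsIndepSet (↑I : Set (Fin n)) then lam ^ I.card else 0)) ≤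
        ∑ I : Finset (Fin n), (if G.IsIndepSet (↑I : Set (Fin n)) then lam ^ I.card else 0) := by
  rintro ⟨θ, hθ, h⟩
  apply hno
  -- choose `j` with `(1+ε)^(2^j) ≥ 2`
  obtain ⟨j, hj⟩ : ∃ j : ℕ, (2 : ℝ) ≤ (1 + ε) ^ (2 ^ j) := by
    obtain ⟨N, hN⟩ := pow_unbounded_of_one_lt (2 : ℝ) (by linarith : (1 : ℝ) < 1 + ε)
    refine ⟨N, le_trans hN.le ?_⟩
    exact pow_le_pow_right₀ (by linarith) (Nat.lt_two_pow_self).le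
  refine ⟨θ / 2 ^ j, div_pos hθ (pow_pos two_pos _), fun n₀ => ?_⟩
  obtain ⟨n, G, H, hn, hG, hH, hhom, hZ⟩ := witnesses_pow hlam hθ (by linarith) h j n₀
  refine ⟨n, G, H, hn, hG, hH, hhom, le_trans ?_ hZ⟩
  exact mul_le_mul_of_nonneg_right hj (Zs_nonneg H hlam)

/-- **The gap factor is immaterial (negative forms equivalent for every `c > 1`).** At `(Δ, λ ≥ 0)`: there are no
factor-`c` twins at any positive exponent iff there are no factor-`2` twins at any positive exponent.  (`c ≤ 2`:
amplify `c = (1 + (c-1))` by `noTwins_onePlusEps_of_noTwins`; `c > 2`: amplify `2` by `witnesses_pow`.) -/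
theorem noTwins_iff_noTwins_two {Δ : ℕ} {lam : ℝ} (hlam : 0 ≤ lam) {c : ℝ} (hc : 1 < c) :
    (¬ ∃ θ : ℝ, 0 < θ ∧ ∀ n₀ : ℕ, ∃ (n : ℕ) (G H : SimpleGraph (Fin n)), n₀ ≤ n ∧
      G.maxDegree ≤ Δ ∧ H.maxDegree ≤ Δ ∧
      (∀ (m : ℕ) (F : SimpleGraph (Fin m)),
        (Literature.Combinatorics.SimpleGraph.treewidth F : ℝ) < (n : ℝ) ^ θ →
          Nat.card (F →g G) = Nat.card (F →g H)) ∧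
      c * (∑ I : Finset (Fin n), (if H.IsIndepSet (↑I : Set (Fin n)) then lam ^ I.card else 0)) ≤
        ∑ I : Finset (Fin n), (if G.IsIndepSet (↑I : Set (Fin n)) then lam ^ I.card else 0)) ↔
    (¬ ∃ θ : ℝ, 0 < θ ∧ ∀ n₀ : ℕ, ∃ (n : ℕ) (G H : SimpleGraph (Fin n)), n₀ ≤ n ∧
      G.maxDegree ≤ Δ ∧ H.maxDegree ≤ Δ ∧
      (∀ (m : ℕ) (F : SimpleGraph (Fin m)),
        (Literature.Combinatorics.SimpleGraph.treewidth F : ℝ) < (n : ℝ) ^ θ →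
          Nat.card (F →g G) = Nat.card (F →g H)) ∧
      2 * (∑ I : Finset (Fin n), (if H.IsIndepSet (↑I : Set (Fin n)) then lam ^ I.card else 0)) ≤
        ∑ I : Finset (Fin n), (if G.IsIndepSet (↑I : Set (Fin n)) then lam ^ I.card else 0)) := by
  constructor
  · -- no `c`-twins ⇒ no `2`-twins: amplify a `2`-family to factor `2^(2^j) ≥ c`
    intro hno
    rintro ⟨θ, hθ, h⟩
    apply hno
    obtain ⟨j, hj⟩ : ∃ j : ℕ, c ≤ (2 : ℝ) ^ (2 ^ j) := by
      obtain ⟨N, hN⟩ := pow_unbounded_of_one_lt c (by norm_num : (1 : ℝ) < 2)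
      exact ⟨N, le_trans hN.le (pow_le_pow_right₀ (by norm_num) (Nat.lt_two_pow_self).le)⟩
    refine ⟨θ / 2 ^ j, div_pos hθ (pow_pos two_pos _), fun n₀ => ?_⟩
    obtain ⟨n, G, H, hn, hG, hH, hhom, hZ⟩ := witnesses_pow hlam hθ (by norm_num : (0:ℝ) ≤ 2) h j n₀
    exact ⟨n, G, H, hn, hG, hH, hhom, le_trans (mul_le_mul_of_nonneg_right hj (Zs_nonneg H hlam)) hZ⟩
  · -- no `2`-twins ⇒ no `c`-twins: `c = 1 + (c - 1)`
    intro hno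
    have := noTwins_onePlusEps_of_noTwins hlam hno (ε := c - 1) (by linarith)
    simpa [add_sub_cancel] using this

/-- **For provers (positive direction, work-file only; not landable by the refuter): a `(1+ε)`-gap at depth `n^θ`
already yields the crux.**  If at every admissible `(Δ, λ)` some exponent `θ > 0` carries `(1+ε)`-twins for SOME
`ε > 0` (depending on `Δ, λ`), then `PolyDepthTwinsAbove` holds: iterate `witnesses_sq` until `(1+ε)^{2^j} ≥ 2`. -/
theorem polyDepthTwinsAbove_of_onePlusEps
    (h : ∀ Δ : ℕ, 3 ≤ Δ → ∀ lam : ℝ, ((Δ : ℝ) - 1) ^ (Δ - 1) / ((Δ : ℝ) - 2) ^ Δ < lam →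
      ∃ ε : ℝ, 0 < ε ∧ ∃ θ : ℝ, 0 < θ ∧ ∀ n₀ : ℕ, ∃ (n : ℕ) (G H : SimpleGraph (Fin n)), n₀ ≤ n ∧
        G.maxDegree ≤ Δ ∧ H.maxDegree ≤ Δ ∧
        (∀ (m : ℕ) (F : SimpleGraph (Fin m)),
          (Literature.Combinatorics.SimpleGraph.treewidth F : ℝ) < (n : ℝ) ^ θ →
            Nat.card (F →g G) = Nat.card (F →g H)) ∧
        (1 + ε) * (∑ I : Finset (Fin n), (if H.IsIndepSet (↑I : Set (Fin n)) then lam ^ I.card else 0)) ≤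
          ∑ I : Finset (Fin n), (if G.IsIndepSet (↑I : Set (Fin n)) then lam ^ I.card else 0)) :
    Summit.PneNP.PneNP.Theses.PhaseTwins.PolyDepthTwinsAbove := by
  intro Δ hΔ lam hlam
  obtain ⟨ε, hε, θ, hθ, hw⟩ := h Δ hΔ lam hlam
  have hlam0 : 0 ≤ lam := by
    have hΔ' : (3 : ℝ) ≤ Δ := by exact_mod_cast hΔ
    have h1 : (0 : ℝ) < (Δ : ℝ) - 1 := by linarith
    have h2 : (0 : ℝ) < (Δ : ℝ) - 2 := by linarith
    have h3 : (0 : ℝ) < ((Δ : ℝ) - 1) ^ (Δ - 1) / ((Δ : ℝ) - 2) ^ Δ := div_pos (pow_pos h1 _) (pow_pos h2 _)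
    linarith
  -- `j` with `(1+ε)^(2^j) ≥ 2`
  obtain ⟨j, hj⟩ : ∃ j : ℕ, (2 : ℝ) ≤ (1 + ε) ^ (2 ^ j) := by
    obtain ⟨N, hN⟩ := pow_unbounded_of_one_lt (2 : ℝ) (by linarith : (1 : ℝ) < 1 + ε)
    exact ⟨N, le_trans hN.le (pow_le_pow_right₀ (by linarith) (Nat.lt_two_pow_self).le)⟩
  refine ⟨θ / 2 ^ j, div_pos hθ (pow_pos two_pos _), fun n₀ => ?_⟩
  obtain ⟨n, G, H, hn, hG, hH, hhom, hZ⟩ := witnesses_pow hlam0 hθ (by linarith) hw j n₀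
  exact ⟨n, G, H, hn, hG, hH, hhom, le_trans (mul_le_mul_of_nonneg_right hj (Zs_nonneg H hlam0)) hZ⟩

end FactorSquaring

end Summit.PneNP.PneNP.Cruxes.PolyDepthTwinsAbove.Disproof
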